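import Literature.ModelTheory.PseudofiniteFields.DefinableSetsFiniteFields
import Mathlib.ModelTheory.Complexity
import Mathlib.Algebra.MvPolynomial.Degrees
import Mathlib.Algebra.MvPolynomial.CommRing
import Mathlib.Algebra.MvPolynomial.Rename
import Mathlib.Algebra.Polynomial.Roots
import Mathlib.Algebra.Polynomial.BigOperators
import Mathlib.Data.Nat.Factorial.Basic
import Mathlib.Algebra.BigOperators.Intervals
import Mathlib.Data.Fintype.Pi
import Mathlib.Data.Fintype.CardEmbedding
import Mathlib.FieldTheory.Finite.Extension
import Mathlib.FieldTheory.PrimitiveElement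
import Mathlib.Algebra.Polynomial.Monic
import HarnessLib

/-!
# Definable sets over finite fields — first reductions towards the CDM Main Theorem (proofs)

Sibling proof file of `DefinableSetsFiniteFields.lean`, working towards the named fact
`Literature.ModelTheory.PseudofiniteFields.ChatzidakisVanDenDriesMacintyre1992_mainTheorem`
(Z. Chatzidakis, L. van den Dries, A. Macintyre, *Definable sets over finite fields*, J. reine
angew. Math. **427** (1992) 107–135, Main Theorem; restated as E. Kowalski, *Exponential sums over
definable subsets of finite fields*, Israel J. Math. 160 (2007), Cor. 13, and D. Macpherson,
C. Steinhorn, *Definability in classes of finite structures* (2011), Thm. 4.2.1).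

## What is proved here (sorry-free, theorems only: no definitions, no named facts)

Two bookkeeping steps that every printed proof of the Main Theorem uses, in the typing of the
vendored fact (`definableCard K φ c`, all finite fields `K : Type`):

* `definableCard_congr` — the number of points of `φ(K^m; c)` is invariant under ring
  isomorphisms `e : K ≃+* K'` (`definableCard K φ c = definableCard K' φ (e ∘ c)`); the transport
  of structure that lets one count in any isomorphic copy of `𝔽_q` (Mathlib's
  `FirstOrder.Ring.languageEquivEquivRingEquiv` and `StrongHomClass.realize_formula`). [folklore]
* `ChatzidakisVanDenDriesMacintyre1992_mainTheorem_of_eventually` — **it suffices to prove the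
  estimate for all sufficiently large finite fields**: if for every `φ` there are `q₀`, `C` and a
  finite `D ⊂ {0,…,m} × ℚ_{>0}` such that the dichotomy "empty or
  `| |φ(K^m;c)| − μ q^d | ≤ C q^{d-1/2}` for some `(d, μ) ∈ D`" holds whenever `q = |K| ≥ q₀`, then
  the Main Theorem holds as stated (for all finite fields, with `C > 0`). This is the last step
  of Kowalski's proof of Cor. 13 (1) ("Replacing the constant `3KB₁` by `max(3KB₁, C)` where
  `C ≥ 0` satisfies [the estimate] for `q ≤ q₀`, we obtain the result for all `q`",
  arXiv:math/0504316 p. 15): in the present typing the finitely many small fields are absorbed by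
  adjoining to `D` the pairs `(0, k)`, `1 ≤ k ≤ q₀^m`, for which the estimate is the triviality
  `|k − k·q⁰| = 0`, using only the bound `|φ(K^m;c)| ≤ q^m` (`definableCard_le_card_pow`).
  [cite: Kowalski2007, proof of Cor. 13 (1)]

## The proof of (3.7) as printed (CDM 1992, §3, pp. 122–125), formalized bottom-up

With the original paper read (open GDZ scan of Crelle 427), the assembly of the PRINTED proof of
the Main Theorem (3.7) is formalized below as theorems (no new definitions, no new named facts),
reducing the Main Theorem to its two printed inputs:

* `exists_rat_sum_descFactorial_eq_one`, `exists_rat_card_ne_zero_eq_sum_descFactorial` —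
  eq. (7): rationals `r_1,…,r_e` depending only on `e` with `card F = ∑_j r_j card H_j`
  (inversion of the triangular system `card H_j = ∑_t ((j+t)!/t!) card F_{j+t}`);
* `cdmEstimate_sum` — finite disjoint unions of pieces satisfying the CDM dichotomy satisfy it
  (how the pairwise disjoint disjuncts (3) are added up);
* `natCard_graph_eq_sum`, `natCard_injTuples_eq_sum_descFactorial`,
  `natCard_exists_eq_card_filter` — the identities (5) for `card G`, `card H_j`, `card F`;
* `cdm37_core` — the whole counting argument (5)–(9) for an abstract relation with fibres of
  `≤ e` points: the (3.5)-outputs for `G` and the `H_j` give, for `q` large, the estimate for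
  `F` with `d ≤ n`, `μ = r_1 μ_1 + ⋯ + r_e μ_e` in a finite set of positive rationals,
  `C = ∑ |r_j| A_j`;
* `isQF_iInf`, `definableCard_relabel_equiv`, `natCard_realize_sum_eq_prod` and
  `cdm37_basicFamily` — the formulas `Ψ_j := ⋀_{i≤j} Ψ(X,Y,Z^i) ∧ ⋀_{i≠i'} Z^i ≠ Z^{i'}` as
  quantifier-free `Language.ring` formulas, their realizations, and (3.7) for one disjunct (3)
  ASSUMING Lemma (3.5) (stated as a hypothesis, integer `μ ∈ {1,…,M}`);
* `mainTheorem_of_qf_of_decomposition` — **the Main Theorem from Lemma (3.5) and the normal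
  form (3)–(4)** of p. 123 (the output of the positive quantifier elimination (2.7) after the
  distributive law, enrichment constants replaced by extra parameters), both as hypotheses.

* `exists_atoms_of_isQF`, `exists_mvPolynomial_of_term`, `exists_forall_eq_zero_iff_forall_prod`
  and `lemma35_of_prop33` — **Lemma (3.5) from Proposition (3.3)** (the latter as a hypothesis
  in dimension-free form: Lang–Weil type estimate with integer `μ ∈ {1,…,M}` for the `K`-points
  of ARBITRARY systems `f_1 = … = f_r = 0` of bounded degree): quantifier-free formulas are
  Boolean combinations of polynomial equations of bounded degree, the sign-pattern disjuncts are
  pairwise disjoint, the positive formula `φ'` with the Rabinowitsch variables `Y'_ν` is one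
  system of equations over a field, and `(x, y') ↦ x` is a bijection; `d ≤ m` by counting;
* `mainTheorem_of_prop33_of_decomposition` — the Main Theorem from Prop. (3.3) and the normal
  form (3)–(4).

* `realize_foldr_add`, `realize_foldr_mul`, `exists_monomials_of_term`,
  `exists_coeffTerms_of_term` — a ring term `g(v, T)` is `∑_i g_i(v) T^i` with coefficient
  TERMS `g_i`; root counting for `g` and for the Rabinowitsch equation `∏_i (g_i U − 1) = 0`;
* `decomposition_of_positiveQE` — **the normal form (3)–(4) from Prop. (2.7)** (the latter as
  the hypothesis "for `q ≥ q₀` and all `c` there are `c'` with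
  `φ(y; c) ↔ ⋀_l ∃T g_l(y, c', T) = 0`"): formula (2), disjointness of its two disjuncts, the
  distributive law, and property (4);
* `mainTheorem_of_prop33_of_positiveQE` — **the Main Theorem from Prop. (3.3) and Prop. (2.7)**,
  the two inputs of the printed proof; everything else of §3 is formalized in this file.

* `exists_monic_irreducible_natDegree_eq`, `exists_enrichment` — every finite field has monic
  irreducible polynomials of every positive degree, hence enrichments in the sense of (2.6);
  `positiveQE_of_prop27` — the hypothesis of `decomposition_of_positiveQE` from the finite-field
  clause of Prop. (2.7) AS PRINTED (for every sufficiently large finite field and EVERY enrichment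
  `c` of it, `φ(x) ↔ ⋀_l ∃T g_l(c, x, T) = 0`); and `mainTheorem_of_prop33_of_prop27` — **the Main
  Theorem from Prop. (3.3) and the finite-field clause of Prop. (2.7), both verbatim as printed**
  (the only deviation: `d ≤ n` for `d ≤ dim V` in (3.3)), so that named facts vendoring these two
  published results discharge the Main Theorem with no further glue.

What then remains of the printed proof, none of it in the tree: Prop. (3.3) (Lang–Weil for
arbitrary `k`-algebraic sets, from Lang–Weil [10] in all dimensions and the bounds (1.7) of the
decomposition–intersection procedure of §1), and Prop. (2.7) (positive
quantifier elimination for enriched pseudo-finite fields: van den Dries' (2.4) for perfect PAC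
fields, the coding (2.2), Weil's theorem making infinite models of the theory of finite fields
pseudo-finite, compactness; plus the existence of enrichments of every finite field).

## What is NOT here: the Main Theorem itself (triaged XL)

The printed proofs (CDM 1992 §§1–4; Kowalski 2007 §§2–3 via ℓ-adic cohomology; Fried–Haran–Jarden
1994 via Galois stratification) all need, none of which the tree has:
(A) the Lang–Weil estimate for absolutely irreducible varieties of every dimension, uniformly in
the complexity — the tree's only Lang–Weil statement is the hypersurface case, the UNPROVED named
fact `Literature.NumberTheory.DiophantineGeometry.CafureMatera2006_thm52` (the Riemann hypothesis
for function fields, `AlgFunctionField.hasseWeil_holds`, IS proved in the tree);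
(B) uniform bounds in families (irreducible components, absolute irreducibility, dimension, étale
loci of the auxiliary covers are constructible in the parameters);
(C) the model theory of pseudo-finite fields (Ax 1968: perfect PAC fields with Galois group `Ẑ`;
the embedding lemma; Kiefe's 1976 near quantifier elimination to Boolean combinations of
`∃ t, f(x̄, t) = 0`);
(D) CDM's Čebotarev-type count for a Galois cover `W → V` over `𝔽_q`
(`#{x ∈ V(𝔽_q) : Frob_x ∈ C} = (|C|/|G|) q^{dim V} + O(q^{dim V - 1/2})`, by twisting and (A)).

## References

* [ChatzidakisVanDenDriesMacintyre1992] Z. Chatzidakis, L. van den Dries, A. Macintyre, Definable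
  sets over finite fields, J. reine angew. Math. 427 (1992) 107–135, Main Theorem and §3
  ((3.2) Lang–Weil, (3.3), (3.5), (3.7) and its proof pp. 123–125); open scan:
  GDZ Göttingen, PPN243919689_0427, LOG_0007.
* [Kowalski2007] E. Kowalski, Exponential sums over definable subsets of finite fields, Israel J.
  Math. 160 (2007) 219–251, Thm. 12, Cor. 13 and its proof (arXiv:math/0504316, pp. 14–15).
* [MacphersonSteinhorn2011] D. Macpherson, C. Steinhorn, Definability in classes of finite
  structures, in: Finite and Algorithmic Model Theory, LMS LNS 379, CUP 2011, Thm. 4.2.1.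
-/

namespace Literature.ModelTheory.PseudofiniteFields

open FirstOrder FirstOrder.Language FirstOrder.Ring

/-! ### Isomorphism invariance of the point count -/

/-- The number of points of a definable set is invariant under ring isomorphisms: for
`e : K ≃+* K'`, `|φ(K^m; c)| = |φ(K'^m; e ∘ c)|` (transport of structure: `e` is an isomorphism of
`L_ring`-structures, so `K ⊨ φ(x̄, c) ↔ K' ⊨ φ(e ∘ x̄, e ∘ c)`). [folklore] -/
theorem definableCard_congr {K K' : Type*} [Field K] [Field K'] (e : K ≃+* K')
    {m n : ℕ} (φ : Language.ring.Formula (Fin m ⊕ Fin n)) (c : Fin n → K) :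
    definableCard K φ c = definableCard K' φ (e ∘ c) := by
  letI := compatibleRingOfRing K
  letI := compatibleRingOfRing K'
  rw [definableCard_def, definableCard_def]
  -- `e` as an isomorphism of structures in the language of rings
  let g : Language.ring.Equiv K K' := languageEquivEquivRingEquiv.symm e
  have hg : ∀ x : K, g x = e x := fun _ => rfl
  refine Nat.card_congr
    { toFun := fun x => ⟨e ∘ x.1, ?_⟩
      invFun := fun y => ⟨e.symm ∘ y.1, ?_⟩
      left_inv := fun x => by ext i; simp
      right_inv := fun y => by ext i; simp }
  · have h := (StrongHomClass.realize_formula g φ (v := Sum.elim x.1 c)).2 x.2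
    rw [Sum.comp_elim] at h
    convert h using 2 <;> funext i <;> simp [hg]
  · have hy := y.2
    have h := (StrongHomClass.realize_formula g φ (v := Sum.elim (e.symm ∘ y.1) c)).1
    rw [Sum.comp_elim] at h
    apply h
    convert hy using 2 <;> funext i <;> simp [hg]

/-! ### Reduction to sufficiently large fields -/

/-- **It suffices to prove the CDM estimate for all sufficiently large finite fields.** If for
every ring formula `φ(x̄; ȳ)` there are `q₀ ∈ ℕ`, `C ∈ ℝ` and a finite set `D` of pairs `(d, μ)`
(`d ≤ m`, `μ ∈ ℚ_{>0}`) such that for every finite field `K` with `|K| ≥ q₀` and all parameters `c`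
the set `φ(K^m; c)` is empty or satisfies `| |φ(K^m;c)| − μ|K|^d | ≤ C|K|^{d − 1/2}` for some
`(d, μ) ∈ D`, then the Main Theorem `ChatzidakisVanDenDriesMacintyre1992_mainTheorem` holds (for all
finite fields, with a constant `C > 0`). Proof: replace `C` by `max C 1` and adjoin to `D` the pairs
`(0, k)`, `1 ≤ k ≤ q₀^m`; a field with `|K| < q₀` has `|φ(K^m;c)| ≤ |K|^m ≤ q₀^m`
(`definableCard_le_card_pow`), so if the set is nonempty its cardinality `k` is one of the adjoined
measures and `|k − k·|K|⁰| = 0`. This is the closing step of Kowalski's proof of the CDM theorem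
("Replacing the constant `3KB₁` by `max(3KB₁, C)` where `C ≥ 0` satisfies [the estimate] for
`q ≤ q₀`, we obtain the result for all `q`"). [cite: Kowalski2007, proof of Cor. 13 (1)] -/
theorem ChatzidakisVanDenDriesMacintyre1992_mainTheorem_of_eventually
    (H : ∀ (m n : ℕ) (φ : Language.ring.Formula (Fin m ⊕ Fin n)),
      ∃ (q₀ : ℕ) (C : ℝ) (D : Finset (ℕ × ℚ)), (∀ dμ ∈ D, dμ.1 ≤ m ∧ 0 < dμ.2) ∧
        ∀ (K : Type) [Field K] [Fintype K] (c : Fin n → K), q₀ ≤ Fintype.card K →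
          definableCard K φ c = 0 ∨
            ∃ dμ ∈ D, |(definableCard K φ c : ℝ) - (dμ.2 : ℝ) * (Fintype.card K : ℝ) ^ dμ.1|
                ≤ C * (Fintype.card K : ℝ) ^ ((dμ.1 : ℝ) - 1 / 2)) :
    ChatzidakisVanDenDriesMacintyre1992_mainTheorem := by
  intro m n φ
  obtain ⟨q₀, C, D, hD, hmain⟩ := H m n φ
  -- the pairs `(0, k)`, `1 ≤ k ≤ q₀ ^ m`, absorb the finitely many small fields
  refine ⟨max C 1, D ∪ (Finset.Icc 1 (q₀ ^ m)).image (fun k : ℕ => ((0 : ℕ), (k : ℚ))),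
    lt_max_of_lt_right one_pos, ?_, ?_⟩
  · intro dμ hdμ
    rcases Finset.mem_union.1 hdμ with h | h
    · exact hD dμ h
    · obtain ⟨k, hk, rfl⟩ := Finset.mem_image.1 h
      have hk1 : 1 ≤ k := (Finset.mem_Icc.1 hk).1
      refine ⟨Nat.zero_le _, ?_⟩
      show (0 : ℚ) < k
      exact_mod_cast hk1
  · intro K _ _ c
    by_cases hq : q₀ ≤ Fintype.card K
    · -- large fields: the hypothesis, with the constant enlarged to `max C 1`
      rcases hmain K c hq with h0 | ⟨dμ, hdμ, hest⟩
      · exact Or.inl h0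
      · exact Or.inr ⟨dμ, Finset.mem_union_left _ hdμ, hest.trans
          (mul_le_mul_of_nonneg_right (le_max_left _ _) (Real.rpow_nonneg (Nat.cast_nonneg _) _))⟩
    · -- small fields: `|φ(K^m;c)| ≤ |K|^m ≤ q₀^m`, and the pair `(0, |φ(K^m;c)|)` fits exactly
      push Not at hq
      by_cases h0 : definableCard K φ c = 0
      · exact Or.inl h0
      · refine Or.inr ⟨((0 : ℕ), (definableCard K φ c : ℚ)), Finset.mem_union_right _ ?_, ?_⟩
        · refine Finset.mem_image.2 ⟨definableCard K φ c, Finset.mem_Icc.2 ⟨?_, ?_⟩, rfl⟩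
          · exact Nat.pos_of_ne_zero h0
          · exact (definableCard_le_card_pow K φ c).trans (Nat.pow_le_pow_left hq.le m)
        · have h1 : |(definableCard K φ c : ℝ)
              - ((definableCard K φ c : ℚ) : ℝ) * (Fintype.card K : ℝ) ^ (0 : ℕ)| = 0 := by
            rw [pow_zero, mul_one, Rat.cast_natCast, sub_self, abs_zero]
          rw [h1]
          positivity

/-! ## The counting core of the printed proof of (3.7) (CDM 1992, §3) -/

section CDM37

universe u v

open Finset

/-! ### (3.7), equation (7): inverting the falling-factorial system -/

/-- The triangular system behind CDM (3.7) eq. (7): for every `e` there are rationals `r 1, …, r e`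
with `∑_{j=1}^{i} r_j · i(i-1)⋯(i-j+1) = 1` for all `1 ≤ i ≤ e` (the matrix
`(i!/(i-j)!)_{j ≤ i}` is unitriangular up to the invertible diagonal `j!`).
[cite: ChatzidakisVanDenDriesMacintyre1992, proof of (3.7), eq. (7)] -/
theorem exists_rat_sum_descFactorial_eq_one (e : ℕ) :
    ∃ r : ℕ → ℚ, ∀ i, 1 ≤ i → i ≤ e →
      ∑ j ∈ Icc 1 i, r j * (i.descFactorial j : ℚ) = 1 := by
  induction e with
  | zero => exact ⟨fun _ => 0, fun i h1 h0 => by omega⟩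
  | succ e ih =>
    obtain ⟨r, hr⟩ := ih
    refine ⟨Function.update r (e + 1)
      ((1 - ∑ j ∈ Icc 1 e, r j * ((e + 1).descFactorial j : ℚ)) / ((e + 1).factorial : ℚ)), ?_⟩
    intro i h1 hi
    rcases Nat.lt_or_ge i (e + 1) with hlt | hge
    · rw [← hr i h1 (by omega)]
      refine sum_congr rfl fun j hj => ?_
      rw [Function.update_of_ne]
      have := (mem_Icc.1 hj).2
      omega
    · obtain rfl : i = e + 1 := le_antisymm hi hge
      rw [sum_Icc_succ_top (by omega : 1 ≤ e + 1), Function.update_self,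
        Nat.descFactorial_self]
      have hsum : ∑ j ∈ Icc 1 e, Function.update r (e + 1)
            ((1 - ∑ j ∈ Icc 1 e, r j * ((e + 1).descFactorial j : ℚ)) / ((e + 1).factorial : ℚ))
            j * ((e + 1).descFactorial j : ℚ)
          = ∑ j ∈ Icc 1 e, r j * ((e + 1).descFactorial j : ℚ) := by
        refine sum_congr rfl fun j hj => ?_
        rw [Function.update_of_ne]
        have := (mem_Icc.1 hj).2
        omega
      rw [hsum]
      have hf : ((e + 1).factorial : ℚ) ≠ 0 := by exact_mod_cast (Nat.factorial_pos _).ne'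
      field_simp
      ring

/-- CDM (3.7), eq. (7), abstract form: there are rationals `r_1, …, r_e` depending only on `e`
such that for every finite family of "fibre sizes" `c y ≤ e` one has
`#{y : c y ≠ 0} = ∑_{j=1}^{e} r_j ∑_y c(y)(c(y)-1)⋯(c(y)-j+1)` — i.e. `card F = ∑_j r_j card H_j`
in the notation of the printed proof (`card H_j = ∑_y (c y)!/(c y - j)!`).
[cite: ChatzidakisVanDenDriesMacintyre1992, proof of (3.7), eq. (7)] -/
theorem exists_rat_card_ne_zero_eq_sum_descFactorial (e : ℕ) :
    ∃ r : ℕ → ℚ, ∀ (Y : Type u) [Fintype Y] (c : Y → ℕ), (∀ y, c y ≤ e) →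
      (((univ.filter fun y => c y ≠ 0).card : ℕ) : ℚ)
        = ∑ j ∈ Icc 1 e, r j * ∑ y, ((c y).descFactorial j : ℚ) := by
  obtain ⟨r, hr⟩ := exists_rat_sum_descFactorial_eq_one e
  refine ⟨r, fun Y _ c hc => ?_⟩
  classical
  -- exchange the sums and evaluate the inner sum pointwise
  have hinner : ∀ y, ∑ j ∈ Icc 1 e, r j * ((c y).descFactorial j : ℚ)
      = if c y ≠ 0 then 1 else 0 := by
    intro y
    split_ifs with hy
    · -- `1 ≤ c y ≤ e`: the terms with `j > c y` vanish
      have h1 : 1 ≤ c y := Nat.pos_of_ne_zero hy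
      rw [← hr (c y) h1 (hc y)]
      symm
      refine sum_subset (Icc_subset_Icc_right (hc y)) fun j hj hj' => ?_
      have hlt : c y < j := by
        rw [mem_Icc] at hj hj'
        omega
      rw [(Nat.descFactorial_eq_zero_iff_lt).2 hlt]
      simp
    · -- `c y = 0`
      push Not at hy
      refine sum_eq_zero fun j hj => ?_
      have h1 : 1 ≤ j := (mem_Icc.1 hj).1
      rw [hy, (Nat.descFactorial_eq_zero_iff_lt).2 (by omega)]
      simp
  calc (((univ.filter fun y => c y ≠ 0).card : ℕ) : ℚ)
      = ∑ y, (if c y ≠ 0 then (1 : ℚ) else 0) := by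
        rw [card_filter]
        push_cast
        rfl
    _ = ∑ y, ∑ j ∈ Icc 1 e, r j * ((c y).descFactorial j : ℚ) := by
        refine sum_congr rfl fun y _ => (hinner y).symm
    _ = ∑ j ∈ Icc 1 e, r j * ∑ y, ((c y).descFactorial j : ℚ) := by
        rw [sum_comm]
        refine sum_congr rfl fun j _ => ?_
        rw [mul_sum]

/-! ### Finite disjoint unions preserve the CDM estimate -/

/-- **Finite (disjoint) unions.** If finitely many counting functions `N_i` each satisfy the CDM
dichotomy "zero, or `|N_i − μ q^d| ≤ C_i q^{d-1/2}` for some `(d, μ)` in a finite set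
`D_i ⊂ {0,…,m} × ℚ_{>0}`", then so does `∑_i N_i`, with the finite set `D'` of pairs
`(max_i d_i, ∑_{i : d_i = max} μ_i)` and `C' = ∑_i (|C_i| + ∑_{D_i} μ)`: the main terms of the
pieces of lower dimension are absorbed in the error since `q^{d_i} ≤ q^{d-1} ≤ q^{d-1/2}`.
This is how the estimates for the pairwise disjoint disjuncts (3) are added up in the proof of
the Main Theorem. Stated for an abstract real `q ≥ 1` and abstract counts, uniformly.
[cite: ChatzidakisVanDenDriesMacintyre1992, proof of (3.7)] -/
theorem cdmEstimate_sum {ι : Type*} [Fintype ι] (m : ℕ) (C : ι → ℝ)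
    (D : ι → Finset (ℕ × ℚ)) (hD : ∀ i, ∀ dμ ∈ D i, dμ.1 ≤ m ∧ 0 < dμ.2) :
    ∃ (C' : ℝ) (D' : Finset (ℕ × ℚ)), (∀ dμ ∈ D', dμ.1 ≤ m ∧ 0 < dμ.2) ∧
      ∀ (q : ℝ), 1 ≤ q → ∀ (N : ι → ℕ),
        (∀ i, N i = 0 ∨ ∃ dμ ∈ D i,
          |(N i : ℝ) - (dμ.2 : ℝ) * q ^ dμ.1| ≤ C i * q ^ ((dμ.1 : ℝ) - 1 / 2)) →
        (∑ i, N i) = 0 ∨ ∃ dμ ∈ D',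
          |((∑ i, N i : ℕ) : ℝ) - (dμ.2 : ℝ) * q ^ dμ.1| ≤ C' * q ^ ((dμ.1 : ℝ) - 1 / 2) := by
  classical
  -- aggregation of a choice `f i ∈ D i ∪ {none}` of pairs: top dimension and total top measure
  let dOf : Option (ℕ × ℚ) → ℕ := fun o => o.elim 0 Prod.fst
  let agg : (ι → Option (ℕ × ℚ)) → ℕ × ℚ := fun f =>
    (univ.sup fun i => dOf (f i),
      ∑ i, (f i).elim (0 : ℚ) fun p => if p.1 = univ.sup (fun i => dOf (f i)) then p.2 else 0)
  refine ⟨∑ i, (|C i| + ∑ dμ ∈ D i, (dμ.2 : ℝ)),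
    ((Fintype.piFinset fun i => insert none ((D i).image some)).image agg).filter
      (fun dμ => 0 < dμ.2), ?_, ?_⟩
  · -- pairs of `D'` have `d ≤ m` and `μ > 0`
    intro dμ hdμ
    rw [mem_filter, mem_image] at hdμ
    obtain ⟨⟨f, hf, rfl⟩, hpos⟩ := hdμ
    refine ⟨?_, hpos⟩
    refine Finset.sup_le fun i _ => ?_
    have hfi := (Fintype.mem_piFinset.1 hf) i
    rcases mem_insert.1 hfi with h | h
    · simp [dOf, h]
    · obtain ⟨p, hp, hpe⟩ := mem_image.1 h
      rw [← hpe]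
      simpa [dOf] using (hD i p hp).1
  · intro q hq N hN
    by_cases hsum : (∑ i, N i) = 0
    · exact Or.inl hsum
    right
    -- choose for each `i` the pair given by `hN` (or `none` when `N i = 0`)
    have key : ∀ i, ∃ o : Option (ℕ × ℚ), (o = none ↔ N i = 0) ∧
        ∀ p, o = some p → p ∈ D i ∧
          |(N i : ℝ) - (p.2 : ℝ) * q ^ p.1| ≤ C i * q ^ ((p.1 : ℝ) - 1 / 2) := by
      intro i
      by_cases h0 : N i = 0
      · exact ⟨none, by simp [h0], fun p hp => by cases hp⟩
      · rcases hN i with h | ⟨dμ, hmem, hest⟩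
        · exact (h0 h).elim
        · exact ⟨some dμ, by simp [h0], fun p hp => by cases hp; exact ⟨hmem, hest⟩⟩
    choose f hf using key
    set d₀ : ℕ := univ.sup fun i => dOf (f i) with hd₀
    set μ₀ : ℚ := ∑ i, (f i).elim (0 : ℚ) fun p => if p.1 = d₀ then p.2 else 0 with hμ₀
    have hagg : agg f = (d₀, μ₀) := rfl
    -- some index carries a pair (since the total count is nonzero)
    obtain ⟨i₁, hi₁⟩ : ∃ i, N i ≠ 0 := by
      by_contra hall
      push Not at hall
      exact hsum (sum_eq_zero fun i _ => hall i)
    have hne : (univ : Finset ι).Nonempty := ⟨i₁, mem_univ _⟩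
    -- every chosen dimension is `≤ d₀`
    have hdle : ∀ i p, f i = some p → p.1 ≤ d₀ := by
      intro i p hp
      have : dOf (f i) ≤ d₀ := Finset.le_sup (f := fun i => dOf (f i)) (mem_univ i)
      simpa [dOf, hp] using this
    -- there is an index whose pair has top dimension `d₀`
    obtain ⟨i₂, p₂, hp₂, hp₂d⟩ : ∃ i p, f i = some p ∧ p.1 = d₀ := by
      obtain ⟨i₃, -, hi₃⟩ := exists_mem_eq_sup univ hne fun i => dOf (f i)
      cases hfi₃ : f i₃ with
      | some p => exact ⟨i₃, p, hfi₃, by simp [hd₀, hi₃, dOf, hfi₃]⟩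
      | none =>
        -- then `d₀ = 0`, and the pair at `i₁` has dimension `0 = d₀`
        have hd0 : d₀ = 0 := by rw [hd₀, hi₃]; simp [dOf, hfi₃]
        cases hfi₁ : f i₁ with
        | none => exact (hi₁ ((hf i₁).1.1 hfi₁)).elim
        | some p => exact ⟨i₁, p, hfi₁, by have := hdle i₁ p hfi₁; omega⟩
    -- the summands of `μ₀` are nonnegative, the one at `i₂` is positive
    have hterm_nonneg : ∀ i, (0 : ℚ) ≤ (f i).elim (0 : ℚ) fun p => if p.1 = d₀ then p.2 else 0 := by
      intro i
      cases hfi : f i with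
      | none => simp
      | some p =>
        have hp := ((hf i).2 p hfi).1
        simp only [Option.elim_some]
        split_ifs
        · exact (hD i p hp).2.le
        · exact le_rfl
    have hμ₀pos : 0 < μ₀ := by
      have h2 : (0 : ℚ) < (f i₂).elim (0 : ℚ) fun p => if p.1 = d₀ then p.2 else 0 := by
        rw [hp₂]
        simp only [Option.elim_some, if_pos hp₂d]
        exact (hD i₂ p₂ ((hf i₂).2 p₂ hp₂).1).2
      rw [hμ₀]
      exact lt_of_lt_of_le h2 (single_le_sum (fun i _ => hterm_nonneg i) (mem_univ i₂))
    refine ⟨(d₀, μ₀), ?_, ?_⟩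
    · rw [mem_filter, mem_image]
      refine ⟨⟨f, ?_, hagg⟩, hμ₀pos⟩
      rw [Fintype.mem_piFinset]
      intro i
      cases hfi : f i with
      | none => exact mem_insert_self _ _
      | some p => exact mem_insert_of_mem (mem_image_of_mem _ ((hf i).2 p hfi).1)
    · -- the estimate
      have hq0 : 0 < q := by linarith
      have hpow_le : ∀ {a b : ℝ}, a ≤ b → q ^ a ≤ q ^ b := fun h =>
        Real.rpow_le_rpow_of_exponent_le hq h
      -- termwise bound
      have hterm : ∀ i, |(N i : ℝ) - (((f i).elim (0 : ℚ) fun p => if p.1 = d₀ then p.2 else 0 : ℚ) : ℝ)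
            * q ^ d₀| ≤ (|C i| + ∑ dμ ∈ D i, (dμ.2 : ℝ)) * q ^ ((d₀ : ℝ) - 1 / 2) := by
        intro i
        have hCi : C i ≤ |C i| := le_abs_self _
        have hDi : (0 : ℝ) ≤ ∑ dμ ∈ D i, (dμ.2 : ℝ) :=
          sum_nonneg fun dμ hdμ => by exact_mod_cast (hD i dμ hdμ).2.le
        have hrpos : (0 : ℝ) ≤ q ^ ((d₀ : ℝ) - 1 / 2) := Real.rpow_nonneg hq0.le _
        cases hfi : f i with
        | none =>
          have h0 : N i = 0 := (hf i).1.1 hfi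
          simp only [h0, Nat.cast_zero, Option.elim_none, Rat.cast_zero, zero_mul, sub_zero,
            abs_zero]
          positivity
        | some p =>
          obtain ⟨hp, hest⟩ := (hf i).2 p hfi
          have hμp : (0 : ℝ) ≤ (p.2 : ℝ) := by exact_mod_cast (hD i p hp).2.le
          have hμle : (p.2 : ℝ) ≤ ∑ dμ ∈ D i, (dμ.2 : ℝ) :=
            single_le_sum (f := fun dμ : ℕ × ℚ => (dμ.2 : ℝ))
              (fun dμ hdμ => by exact_mod_cast (hD i dμ hdμ).2.le) hp
          simp only [Option.elim_some]
          by_cases hpd : p.1 = d₀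
          · rw [if_pos hpd, ← hpd]
            calc |(N i : ℝ) - (p.2 : ℝ) * q ^ p.1|
                ≤ C i * q ^ ((p.1 : ℝ) - 1 / 2) := hest
              _ ≤ (|C i| + ∑ dμ ∈ D i, (dμ.2 : ℝ)) * q ^ ((p.1 : ℝ) - 1 / 2) := by
                  apply mul_le_mul_of_nonneg_right _ (Real.rpow_nonneg hq0.le _)
                  linarith
          · rw [if_neg hpd, Rat.cast_zero, zero_mul, sub_zero]
            have hlt : p.1 < d₀ := lt_of_le_of_ne (hdle i p hfi) hpd
            have h1 : (p.1 : ℝ) + 1 ≤ d₀ := by exact_mod_cast hlt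
            have hqp : q ^ p.1 ≤ q ^ ((d₀ : ℝ) - 1 / 2) := by
              rw [← Real.rpow_natCast]
              exact hpow_le (by linarith)
            have hqp' : q ^ ((p.1 : ℝ) - 1 / 2) ≤ q ^ ((d₀ : ℝ) - 1 / 2) := hpow_le (by linarith)
            calc |(N i : ℝ)| = |((N i : ℝ) - (p.2 : ℝ) * q ^ p.1) + (p.2 : ℝ) * q ^ p.1| := by
                  rw [sub_add_cancel]
              _ ≤ |(N i : ℝ) - (p.2 : ℝ) * q ^ p.1| + |(p.2 : ℝ) * q ^ p.1| := abs_add_le _ _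
              _ ≤ C i * q ^ ((p.1 : ℝ) - 1 / 2) + (p.2 : ℝ) * q ^ p.1 := by
                  have hpq : (0 : ℝ) ≤ (p.2 : ℝ) * q ^ p.1 := by positivity
                  rw [abs_of_nonneg hpq]
                  linarith [hest]
              _ ≤ |C i| * q ^ ((d₀ : ℝ) - 1 / 2)
                  + (∑ dμ ∈ D i, (dμ.2 : ℝ)) * q ^ ((d₀ : ℝ) - 1 / 2) := by
                  gcongr ?_ + ?_
                  · calc C i * q ^ ((p.1 : ℝ) - 1 / 2) ≤ |C i| * q ^ ((p.1 : ℝ) - 1 / 2) :=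
                        mul_le_mul_of_nonneg_right hCi (Real.rpow_nonneg hq0.le _)
                      _ ≤ |C i| * q ^ ((d₀ : ℝ) - 1 / 2) :=
                        mul_le_mul_of_nonneg_left hqp' (abs_nonneg _)
                  · exact mul_le_mul hμle hqp (by positivity) hDi
              _ = (|C i| + ∑ dμ ∈ D i, (dμ.2 : ℝ)) * q ^ ((d₀ : ℝ) - 1 / 2) := by ring
      -- sum up
      have hcast : ((∑ i, N i : ℕ) : ℝ) - ((μ₀ : ℚ) : ℝ) * q ^ d₀
          = ∑ i, ((N i : ℝ) - (((f i).elim (0 : ℚ) fun p => if p.1 = d₀ then p.2 else 0 : ℚ) : ℝ)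
              * q ^ d₀) := by
        rw [hμ₀]
        push_cast
        rw [sum_sub_distrib, sum_mul]
      show |((∑ i, N i : ℕ) : ℝ) - ((μ₀ : ℚ) : ℝ) * q ^ d₀|
          ≤ (∑ i, (|C i| + ∑ dμ ∈ D i, (dμ.2 : ℝ))) * q ^ ((d₀ : ℝ) - 1 / 2)
      rw [hcast, sum_mul]
      exact (abs_sum_le_sum_abs _ _).trans (sum_le_sum fun i _ => hterm i)


/-! ### Counting identities behind (5): the cardinalities of `F`, `G`, `H_j` -/

section Counting

variable {Y Z : Type*} (Rel : Y → Z → Prop)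

/-- `card G = ∑_y card(fibre)`: the graph of a relation counted over the first projection.
[folklore] -/
theorem natCard_graph_eq_sum [Fintype Y] [Finite Z] :
    Nat.card {p : Y × Z // Rel p.1 p.2} = ∑ y, Nat.card {z // Rel y z} := by
  classical
  cases nonempty_fintype Z
  rw [Nat.card_congr (Equiv.subtypeProdEquivSigmaSubtype Rel), Nat.card_eq_fintype_card,
    Fintype.card_sigma]
  simp only [Nat.card_eq_fintype_card]

/-- `card H_j = ∑_y c(y)(c(y)-1)⋯(c(y)-j+1)` (`c(y)` = size of the fibre over `y`): the number of
pairs `(y, (z_1,…,z_j))` with `z_1,…,z_j` pairwise distinct points of the fibre over `y` ("each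
point `y ∈ F_{j+t}` gives rise to `(j+t)!/t!` points in `H_j`").
[cite: ChatzidakisVanDenDriesMacintyre1992, proof of (3.7), p. 124] -/
theorem natCard_injTuples_eq_sum_descFactorial [Fintype Y] [Finite Z] (j : ℕ) :
    Nat.card {p : Y × (Fin j → Z) // (∀ i, Rel p.1 (p.2 i)) ∧ Function.Injective p.2}
      = ∑ y, (Nat.card {z // Rel y z}).descFactorial j := by
  classical
  cases nonempty_fintype Z
  let E₁ : {p : Y × (Fin j → Z) // (∀ i, Rel p.1 (p.2 i)) ∧ Function.Injective p.2}
      ≃ Σ y, {f : Fin j → Z // (∀ i, Rel y (f i)) ∧ Function.Injective f} :=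
    Equiv.subtypeProdEquivSigmaSubtype
      (fun y (f : Fin j → Z) => (∀ i, Rel y (f i)) ∧ Function.Injective f)
  let E₂ : ∀ y, {f : Fin j → Z // (∀ i, Rel y (f i)) ∧ Function.Injective f}
      ≃ (Fin j ↪ {z // Rel y z}) := fun y =>
    { toFun := fun f => ⟨fun i => ⟨f.1 i, f.2.1 i⟩, fun i i' h => f.2.2 (congrArg Subtype.val h)⟩
      invFun := fun g => ⟨fun i => (g i).1, fun i => (g i).2,
        fun i i' h => g.injective (Subtype.ext h)⟩
      left_inv := fun f => rfl
      right_inv := fun g => rfl }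
  rw [Nat.card_congr E₁, Nat.card_eq_fintype_card, Fintype.card_sigma]
  refine sum_congr rfl fun y _ => ?_
  rw [Fintype.card_congr (E₂ y), Fintype.card_embedding_eq, Fintype.card_fin,
    Nat.card_eq_fintype_card]

/-- `card F = #{y : the fibre over y is nonempty}`. [folklore] -/
theorem natCard_exists_eq_card_filter [Fintype Y] [Finite Z] :
    Nat.card {y // ∃ z, Rel y z}
      = (univ.filter fun y => Nat.card {z // Rel y z} ≠ 0).card := by
  classical
  rw [Nat.card_eq_fintype_card, Fintype.card_subtype]
  congr 1
  refine filter_congr fun y _ => ?_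
  rw [Nat.card_ne_zero]
  exact ⟨fun ⟨z, hz⟩ => ⟨⟨⟨z, hz⟩⟩, inferInstance⟩, fun ⟨⟨⟨z, hz⟩⟩, _⟩ => ⟨z, hz⟩⟩

end Counting

/-! ### The core of the proof of (3.7) -/

/-- **CDM (3.7), the counting core** (equations (5)–(9) of the printed proof), for an abstract
relation `Rel ⊆ Y × Z` (the set `Ψ(x, k^{n+k})` fibred over `y`) whose fibres over `Y` have
`≤ e` points (property (4)). Write `F = {y : ∃ z, Rel y z}`, `G = {(y,z) : Rel y z}`,
`H_j = {(y, z_1, …, z_j) : Rel y z_i (∀ i), z_i ≠ z_{i'} (i ≠ i')}`. Assume the outputs of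
Lemma (3.5) for `G` and for the `H_j`, `1 ≤ j ≤ e`: each is empty or satisfies
`|card − μ q^d| ≤ A q^{d−1/2}` for an INTEGER `μ ∈ {1,…,N}` and some `d` (a priori unrelated
`d`'s). Then for `q` larger than a constant `q₁` depending only on `(e, n', N, A, (M_j), (A'_j))`,
if `card Y ≤ q^{n'}`: `F` is empty, or `|card F − ρ q^d| ≤ C q^{d−1/2}` where `d ≤ n'` is the
dimension attached to `G`, `ρ` lies in a finite set `R ⊂ ℚ_{>0}` and `C` depends only on the
same data. As printed: (5) `card G = ∑_j j·card F_j ≤ e·card F`; (6)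
`card F ≥ (μ/e) q^d − (A/e) q^{d−1/2}`, hence `d ≤ n'` since `q` is large;
`card H_j ≤ e^{j−1} card G`, hence the `H_j`-dimensions are `≤ d` and (8)
`|card H_j − μ_j q^d| ≤ A_j q^{d−1/2}` with `μ_j ∈ {0,…,M_j}`; (7)
`card F = r_1 card H_1 + ⋯ + r_e card H_e` (`exists_rat_card_ne_zero_eq_sum_descFactorial`);
(9) by summing, with `ρ = r_1 μ_1 + ⋯ + r_e μ_e` and `C = ∑ |r_j| A_j`; finally
`ρ ≥ μ/e − O(q^{-1/2}) > 0`. All counts are `Nat.card`s and `q` is an abstract real.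
[cite: ChatzidakisVanDenDriesMacintyre1992, proof of (3.7), pp. 124–125] -/
theorem cdm37_core (e n' N : ℕ) (A : ℝ) (M : ℕ → ℕ) (A' : ℕ → ℝ) :
    ∃ (q₁ C : ℝ) (R : Finset ℚ), (∀ ρ ∈ R, 0 < ρ) ∧
      ∀ (q : ℝ), q₁ ≤ q → ∀ (Y : Type u) (Z : Type v) [Finite Y] [Finite Z] (Rel : Y → Z → Prop),
        (∀ y, Nat.card {z // Rel y z} ≤ e) →
        ((Nat.card Y : ℝ) ≤ q ^ n') →
        (Nat.card {p : Y × Z // Rel p.1 p.2} = 0 ∨ ∃ d μ : ℕ, (1 ≤ μ ∧ μ ≤ N) ∧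
            |(Nat.card {p : Y × Z // Rel p.1 p.2} : ℝ) - μ * q ^ d|
              ≤ A * q ^ ((d : ℝ) - 1 / 2)) →
        (∀ j, 1 ≤ j → j ≤ e →
          Nat.card {p : Y × (Fin j → Z) // (∀ i, Rel p.1 (p.2 i)) ∧ Function.Injective p.2} = 0 ∨
            ∃ d μ : ℕ, (1 ≤ μ ∧ μ ≤ M j) ∧
              |(Nat.card {p : Y × (Fin j → Z) //
                    (∀ i, Rel p.1 (p.2 i)) ∧ Function.Injective p.2} : ℝ) - μ * q ^ d|
                ≤ A' j * q ^ ((d : ℝ) - 1 / 2)) →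
        Nat.card {y // ∃ z, Rel y z} = 0 ∨
          ∃ d : ℕ, d ≤ n' ∧ ∃ ρ ∈ R,
            |(Nat.card {y // ∃ z, Rel y z} : ℝ) - (ρ : ℝ) * q ^ d|
              ≤ C * q ^ ((d : ℝ) - 1 / 2) := by
  classical
  obtain ⟨r, hr⟩ := exists_rat_card_ne_zero_eq_sum_descFactorial.{u} e
  -- the constant of (9)
  set C : ℝ := ∑ j ∈ Icc 1 e, |(r j : ℝ)| * ((M j : ℝ) + |A' j|) with hC
  have hC0 : 0 ≤ C := sum_nonneg fun j _ => by positivity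
  -- the finite set of positive rationals `r_1 μ_1 + ⋯ + r_e μ_e`, `μ_j ∈ {0,…,M_j}`
  let pad : (Fin (e + 1) → ℕ) → ℕ → ℕ := fun μs j => if h : j < e + 1 then μs ⟨j, h⟩ else 0
  set R : Finset ℚ := ((Fintype.piFinset fun j : Fin (e + 1) => range (M j + 1)).image
      fun μs => ∑ j ∈ Icc 1 e, r j * (pad μs j : ℚ)).filter (fun ρ => 0 < ρ) with hR
  -- the quantity bounding `card H_j / q^d`
  set B : ℝ := (e : ℝ) ^ e * ((N : ℝ) + |A|) with hB
  have hB0 : 0 ≤ B := by positivity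
  refine ⟨2 + 2 * e + 4 * A ^ 2 + (|A| + e * C + 1) ^ 2
      + ∑ j ∈ Icc 1 e, (B + |A' j| + 1) ^ 2, C, R, fun ρ hρ => (mem_filter.1 hρ).2, ?_⟩
  intro q hq Y Z _ _ Rel hfib hY hG hH
  cases nonempty_fintype Y
  cases nonempty_fintype Z
  /- unpacking the largeness of `q` -/
  have hsumsq : 0 ≤ ∑ j ∈ Icc 1 e, (B + |A' j| + 1) ^ 2 := sum_nonneg fun j _ => by positivity
  have he0' : (0 : ℝ) ≤ e := Nat.cast_nonneg e
  have hA2 : 0 ≤ A ^ 2 := sq_nonneg A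
  have hAC2 : 0 ≤ (|A| + e * C + 1) ^ 2 := sq_nonneg _
  have hq2 : (2 : ℝ) ≤ q := by linarith only [hq, he0', hA2, hAC2, hsumsq]
  have hq1 : (1 : ℝ) ≤ q := by linarith only [hq2]
  have hq0 : (0 : ℝ) < q := by linarith only [hq2]
  have hqe : 2 * (e : ℝ) < q := by linarith only [hq, he0', hA2, hAC2, hsumsq]
  set s : ℝ := q ^ (1 / 2 : ℝ) with hs
  have hs_sqrt : s = Real.sqrt q := by rw [hs, Real.sqrt_eq_rpow]
  have hs0 : 0 < s := Real.rpow_pos_of_pos hq0 _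
  have hs_ge : ∀ t : ℝ, 0 ≤ t → t ^ 2 ≤ q → t ≤ s := fun t ht htq => by
    rw [hs_sqrt]; exact (Real.le_sqrt ht hq0.le).2 htq
  have hsA : 2 * |A| ≤ s := hs_ge _ (by positivity) (by
    have : (2 * |A|) ^ 2 = 4 * A ^ 2 := by rw [mul_pow, sq_abs]; norm_num
    linarith only [hq, this, he0', hAC2, hsumsq])
  have hsC : |A| + e * C + 1 ≤ s :=
    hs_ge _ (by positivity) (by linarith only [hq, he0', hA2, hsumsq])
  have hs1 : 1 ≤ s := by linarith only [hsC, abs_nonneg A, mul_nonneg he0' hC0]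
  have hsA' : ∀ j, 1 ≤ j → j ≤ e → B + |A' j| + 1 ≤ s := fun j hj1 hje =>
    hs_ge _ (by positivity) (by
      have : (B + |A' j| + 1) ^ 2 ≤ ∑ j ∈ Icc 1 e, (B + |A' j| + 1) ^ 2 :=
        single_le_sum (f := fun j => (B + |A' j| + 1) ^ 2) (fun j _ => by positivity)
          (mem_Icc.2 ⟨hj1, hje⟩)
      linarith only [hq, this, he0', hA2, hAC2])
  -- powers of `q`
  have hpow_le : ∀ {a b : ℝ}, a ≤ b → q ^ a ≤ q ^ b := fun h =>
    Real.rpow_le_rpow_of_exponent_le hq1 h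
  have hPd : ∀ d : ℕ, q ^ ((d : ℝ) - 1 / 2) * s = q ^ d := fun d => by
    rw [hs, ← Real.rpow_add hq0, sub_add_cancel, Real.rpow_natCast]
  have hP0 : ∀ d : ℕ, 0 < q ^ ((d : ℝ) - 1 / 2) := fun d => Real.rpow_pos_of_pos hq0 _
  /- the fibre sizes and the three counts -/
  set c : Y → ℕ := fun y => Nat.card {z // Rel y z} with hc
  have hce : ∀ y, c y ≤ e := hfib
  set NF : ℕ := Nat.card {y // ∃ z, Rel y z} with hNF
  set NG : ℕ := Nat.card {p : Y × Z // Rel p.1 p.2} with hNG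
  have hNF_eq : NF = (univ.filter fun y => c y ≠ 0).card := natCard_exists_eq_card_filter Rel
  have hNG_eq : NG = ∑ y, c y := natCard_graph_eq_sum Rel
  have hNH_eq : ∀ j, Nat.card {p : Y × (Fin j → Z) //
      (∀ i, Rel p.1 (p.2 i)) ∧ Function.Injective p.2} = ∑ y, (c y).descFactorial j :=
    natCard_injTuples_eq_sum_descFactorial Rel
  by_cases hF0 : NF = 0
  · exact Or.inl hF0
  right
  /- (5): `card G ≤ e · card F`, and `G ≠ ∅` -/
  have hGeF_nat : NG ≤ e * NF := by
    rw [hNG_eq, hNF_eq, card_filter, mul_sum]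
    refine sum_le_sum fun y _ => ?_
    split_ifs with h
    · simpa using hce y
    · simp [not_not.1 h]
  have hGeF : (NG : ℝ) ≤ e * NF := by exact_mod_cast hGeF_nat
  have hG0 : NG ≠ 0 := by
    intro h0
    rw [hNG_eq, sum_eq_zero_iff] at h0
    apply hF0
    rw [hNF_eq, card_eq_zero, filter_eq_empty_iff]
    exact fun y _ => not_not.2 (h0 y (mem_univ y))
  have he1 : (1 : ℝ) ≤ e := by
    rcases Nat.eq_zero_or_pos e with h | h
    · exfalso; apply hG0; simpa [h] using hGeF_nat
    · exact_mod_cast h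
  /- the estimate for `G` -/
  obtain ⟨d, μ, ⟨hμ1, hμN⟩, hGest⟩ := hG.resolve_left hG0
  set P : ℝ := q ^ ((d : ℝ) - 1 / 2) with hP
  have hP0' : 0 < P := hP0 d
  have hqd : q ^ d = P * s := (hPd d).symm
  have hμ1' : (1 : ℝ) ≤ μ := by exact_mod_cast hμ1
  have hμN' : (μ : ℝ) ≤ N := by exact_mod_cast hμN
  rw [hqd] at hGest
  obtain ⟨hGup, hGlow⟩ := abs_sub_le_iff.1 hGest
  have hAP : A * P ≤ |A| * P := mul_le_mul_of_nonneg_right (le_abs_self A) hP0'.le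
  have hPs0 : 0 < P * s := mul_pos hP0' hs0
  -- `card G ≤ (N + |A|) q^d`
  have hGbound : (NG : ℝ) ≤ ((N : ℝ) + |A|) * (P * s) := by
    have h1 : (μ : ℝ) * (P * s) ≤ N * (P * s) := mul_le_mul_of_nonneg_right hμN' hPs0.le
    have h2 : |A| * P ≤ |A| * (P * s) :=
      mul_le_mul_of_nonneg_left (le_mul_of_one_le_right hP0'.le hs1) (abs_nonneg A)
    linarith only [hGup, h1, h2, hAP]
  /- (6): `e · card F ≥ q^d − |A| q^{d−1/2} ≥ q^d / 2` -/
  have hFlow : P * (s - |A|) ≤ e * NF := by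
    have h2 : P * s ≤ (μ : ℝ) * (P * s) := le_mul_of_one_le_left hPs0.le hμ1'
    linarith only [hGlow, h2, hAP, hGeF]
  have hFlow2 : P * s ≤ 2 * e * NF := by
    have h2 : P * (2 * |A|) ≤ P * s := mul_le_mul_of_nonneg_left hsA hP0'.le
    linarith only [hFlow, h2]
  /- hence `d ≤ n'` -/
  have hdn : d ≤ n' := by
    by_contra hlt
    push Not at hlt
    have h1 : q ^ n' * q ≤ q ^ d := by
      rw [← pow_succ]
      exact pow_le_pow_right₀ hq1 hlt
    rw [hqd] at h1
    have hNFY : (NF : ℝ) ≤ q ^ n' := by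
      have : NF ≤ Nat.card Y := Finite.card_subtype_le _
      exact le_trans (by exact_mod_cast this) hY
    have hqn0 : (0 : ℝ) < q ^ n' := pow_pos hq0 _
    have h4 : 2 * (e : ℝ) * NF ≤ 2 * e * q ^ n' :=
      mul_le_mul_of_nonneg_left hNFY (by positivity)
    have h2 : q ^ n' * q ≤ q ^ n' * (2 * e) := by linarith only [h1, hFlow2, h4]
    have h3 : q ≤ 2 * e := le_of_mul_le_mul_left h2 hqn0
    linarith only [h3, hqe]
  /- (8): the `H_j` have dimension `≤ d`; estimates with the SAME `d` and `μ_j ∈ {0,…,M_j}` -/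
  have hH' : ∀ j, ∃ μ' : ℕ, μ' ≤ M j ∧ (1 ≤ j → j ≤ e →
      |(Nat.card {p : Y × (Fin j → Z) // (∀ i, Rel p.1 (p.2 i)) ∧ Function.Injective p.2} : ℝ)
          - μ' * (P * s)| ≤ ((M j : ℝ) + |A' j|) * P) := by
    intro j
    by_cases hj : 1 ≤ j ∧ j ≤ e
    swap
    · exact ⟨0, Nat.zero_le _, fun h1 h2 => (hj ⟨h1, h2⟩).elim⟩
    obtain ⟨hj1, hje⟩ := hj
    set NH : ℕ := Nat.card {p : Y × (Fin j → Z) //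
      (∀ i, Rel p.1 (p.2 i)) ∧ Function.Injective p.2} with hNH
    have hMA0 : (0 : ℝ) ≤ ((M j : ℝ) + |A' j|) * P := by positivity
    have hA'le : A' j ≤ |A' j| := le_abs_self _
    have hsj := hsA' j hj1 hje
    -- `card H_j ≤ e^{j-1} card G ≤ B q^d`
    have hHG : (NH : ℝ) ≤ (e : ℝ) ^ (j - 1) * NG := by
      have h : NH ≤ e ^ (j - 1) * NG := by
        rw [hNH, hNH_eq, hNG_eq, mul_sum]
        refine sum_le_sum fun y _ => ?_
        calc (c y).descFactorial j ≤ (c y) ^ j := Nat.descFactorial_le_pow _ _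
          _ = (c y) ^ (j - 1) * c y := by
              conv_lhs => rw [show j = (j - 1) + 1 by omega, pow_succ]
          _ ≤ e ^ (j - 1) * c y := Nat.mul_le_mul_right _ (Nat.pow_le_pow_left (hce y) _)
      exact_mod_cast h
    have hHB : (NH : ℝ) ≤ B * (P * s) := by
      have h1 : (e : ℝ) ^ (j - 1) ≤ (e : ℝ) ^ e := pow_le_pow_right₀ he1 (by omega)
      calc (NH : ℝ) ≤ (e : ℝ) ^ (j - 1) * NG := hHG
        _ ≤ (e : ℝ) ^ e * (((N : ℝ) + |A|) * (P * s)) :=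
            mul_le_mul h1 hGbound (by positivity) (by positivity)
        _ = B * (P * s) := by rw [hB]; ring
    rcases hH j hj1 hje with h0 | ⟨dj, μj, ⟨hμj1, hμjM⟩, hest⟩
    · refine ⟨0, Nat.zero_le _, fun _ _ => ?_⟩
      have h0' : NH = 0 := h0
      rw [h0']
      simpa using hMA0
    · have hμj1' : (1 : ℝ) ≤ μj := by exact_mod_cast hμj1
      have hμjM' : (μj : ℝ) ≤ M j := by exact_mod_cast hμjM
      set Pj : ℝ := q ^ ((dj : ℝ) - 1 / 2) with hPj
      have hPj0 : 0 < Pj := hP0 dj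
      have hqdj : q ^ dj = Pj * s := (hPd dj).symm
      have hest' : |(NH : ℝ) - μj * (Pj * s)| ≤ A' j * Pj := by rw [← hqdj]; exact hest
      obtain ⟨hup, hlow⟩ := abs_sub_le_iff.1 hest'
      have hA'P : A' j * Pj ≤ |A' j| * Pj := mul_le_mul_of_nonneg_right hA'le hPj0.le
      rcases lt_trichotomy dj d with hlt | heq | hgt
      · -- lower dimension: the main term is absorbed in the error, `μ_j = 0`
        refine ⟨0, Nat.zero_le _, fun _ _ => ?_⟩
        rw [Nat.cast_zero, zero_mul, sub_zero, abs_of_nonneg (Nat.cast_nonneg _)]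
        have h1 : (dj : ℝ) + 1 ≤ d := by exact_mod_cast hlt
        have hPjs : Pj * s ≤ P := by
          rw [hPj, hP, hs, ← Real.rpow_add hq0]
          exact hpow_le (by linarith only [h1])
        have hPjP : Pj ≤ P := by
          rw [hPj, hP]
          exact hpow_le (by linarith only [h1])
        have h2 : (μj : ℝ) * (Pj * s) ≤ (M j : ℝ) * (Pj * s) :=
          mul_le_mul_of_nonneg_right hμjM' (by positivity)
        have h3 : (M j : ℝ) * (Pj * s) ≤ (M j : ℝ) * P :=
          mul_le_mul_of_nonneg_left hPjs (Nat.cast_nonneg _)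
        have h4 : |A' j| * Pj ≤ |A' j| * P := mul_le_mul_of_nonneg_left hPjP (abs_nonneg _)
        linarith only [hup, hA'P, h2, h3, h4]
      · -- same dimension: `μ_j` as given
        refine ⟨μj, hμjM, fun _ _ => ?_⟩
        have hPP : Pj = P := by rw [hPj, hP, heq]
        rw [hPP] at hup hlow hA'P
        rw [abs_sub_le_iff]
        have h2 : (0 : ℝ) ≤ (M j : ℝ) * P := by positivity
        constructor
        · linarith only [hup, hA'P, h2]
        · linarith only [hlow, hA'P, h2]
      · -- higher dimension is impossible for `q` this large
        exfalso
        have h1 : (d : ℝ) + 1 ≤ dj := by exact_mod_cast hgt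
        have hPjP : P * s ≤ Pj := by
          rw [hPj, hP, hs, ← Real.rpow_add hq0]
          exact hpow_le (by linarith only [h1])
        have hsA'j : 0 ≤ s - |A' j| := by linarith only [hsj, hB0]
        -- `Pj (s − |A'_j|) ≤ card H_j ≤ B q^d = B P s` and `Pj ≥ P s` give `s − |A'_j| ≤ B`
        have h2 : Pj * (s - |A' j|) ≤ NH := by
          have h5 : Pj * s ≤ (μj : ℝ) * (Pj * s) := le_mul_of_one_le_left (by positivity) hμj1'
          linarith only [hlow, h5, hA'P]
        have h6 : P * s * (s - |A' j|) ≤ B * (P * s) :=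
          le_trans (mul_le_mul_of_nonneg_right hPjP hsA'j) (h2.trans hHB)
        have h6' : P * s * (s - |A' j|) ≤ P * s * B := by linarith only [h6]
        have h7 : s - |A' j| ≤ B := le_of_mul_le_mul_left h6' hPs0
        linarith only [h7, hsj]
  choose μ' hμ'M hμ'est using hH'
  /- (7): `card F = ∑_j r_j card H_j` -/
  have h7 : (NF : ℝ) = ∑ j ∈ Icc 1 e, (r j : ℝ) * ∑ y, ((c y).descFactorial j : ℝ) := by
    have h := hr Y c hce
    rw [← hNF_eq] at h
    have h' := congrArg (fun x : ℚ => (x : ℝ)) h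
    push_cast at h'
    exact h'
  /- (9) -/
  set ρ : ℚ := ∑ j ∈ Icc 1 e, r j * (μ' j : ℚ) with hρ
  have h9 : |(NF : ℝ) - (ρ : ℝ) * (P * s)| ≤ C * P := by
    have hexp : (NF : ℝ) - (ρ : ℝ) * (P * s) = ∑ j ∈ Icc 1 e,
        (r j : ℝ) * ((∑ y, ((c y).descFactorial j : ℝ)) - (μ' j : ℝ) * (P * s)) := by
      rw [h7, hρ]
      push_cast
      rw [sum_mul, ← sum_sub_distrib]
      exact sum_congr rfl fun j _ => by ring
    rw [hexp, hC, sum_mul]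
    refine (abs_sum_le_sum_abs _ _).trans (sum_le_sum fun j hj => ?_)
    obtain ⟨hj1, hje⟩ := mem_Icc.1 hj
    have h := hμ'est j hj1 hje
    rw [hNH_eq j] at h
    push_cast at h
    rw [abs_mul, mul_assoc]
    exact mul_le_mul_of_nonneg_left h (abs_nonneg _)
  /- `ρ > 0` -/
  have hρpos : 0 < ρ := by
    by_contra hle
    push Not at hle
    have hle' : (ρ : ℝ) ≤ 0 := by exact_mod_cast hle
    obtain ⟨hup, -⟩ := abs_sub_le_iff.1 h9
    have h0 : (ρ : ℝ) * (P * s) ≤ 0 := mul_nonpos_of_nonpos_of_nonneg hle' hPs0.le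
    have h1 : (NF : ℝ) ≤ C * P := by linarith only [hup, h0]
    have h2 : P * (s - |A|) ≤ e * (C * P) := hFlow.trans (mul_le_mul_of_nonneg_left h1 he0')
    have h4 : P * (s - |A|) ≤ P * (e * C) := by linarith only [h2]
    have h3 : s - |A| ≤ e * C := le_of_mul_le_mul_left h4 hP0'
    linarith only [h3, hsC]
  /- `ρ ∈ R` -/
  have hρR : ρ ∈ R := by
    rw [hR, mem_filter]
    refine ⟨mem_image.2 ⟨fun j => μ' j, ?_, ?_⟩, hρpos⟩
    · rw [Fintype.mem_piFinset]
      exact fun j => mem_range.2 (Nat.lt_succ_of_le (hμ'M j))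
    · rw [hρ]
      refine sum_congr rfl fun j hj => ?_
      obtain ⟨-, hje⟩ := mem_Icc.1 hj
      simp only [pad, dif_pos (Nat.lt_succ_of_le hje)]
  refine ⟨d, hdn, ρ, hρR, ?_⟩
  rw [hqd]
  exact h9


/-! ## From the counting core to definable families: the formulas `Ψ_j` and Lemma (3.5) -/

section CDM37Syntax

open FirstOrder FirstOrder.Language FirstOrder.Ring BoundedFormula

/-- Conjunctions of finitely many quantifier-free formulas are quantifier-free. [folklore] -/
theorem isQF_iInf {L : Language} {α β : Type*} {n : ℕ} [Finite β]
    {f : β → L.BoundedFormula α n} (h : ∀ b, (f b).IsQF) : (BoundedFormula.iInf f).IsQF := by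
  letI : Fintype β := Fintype.ofFinite β
  unfold BoundedFormula.iInf
  show (((Finset.univ : Finset β).toList.map f).foldr (· ⊓ ·) ⊤).IsQF
  suffices h' : ∀ l : List (L.BoundedFormula α n), (∀ φ ∈ l, φ.IsQF) →
      (l.foldr (· ⊓ ·) ⊤).IsQF from
    h' _ fun φ hφ => by
      obtain ⟨b, -, rfl⟩ := List.mem_map.1 hφ
      exact h b
  intro l hl
  induction l with
  | nil => exact IsQF.top
  | cons φ l ih =>
    exact (hl φ (by simp)).inf (ih fun ψ hψ => hl ψ (by simp [hψ]))

/-- Relabelling a quantifier-free formula gives a quantifier-free formula. [folklore] -/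
theorem isQF_formulaRelabel {L : Language} {α β : Type*} {φ : L.Formula α} (h : φ.IsQF)
    (g : α → β) : (φ.relabel g).IsQF :=
  h.relabel _

/-- `definableCard` in an arbitrary finite indexing of the set variables: relabelling the set
variables along `eα : α ≃ Fin N` does not change the number of points. [folklore] -/
theorem definableCard_relabel_equiv (K : Type*) [Add K] [Mul K] [Neg K] [One K] [Zero K]
    {α : Type*} {N n : ℕ} (eα : α ≃ Fin N) (ψ : Language.ring.Formula (α ⊕ Fin n))
    (c : Fin n → K) :
    definableCard K (ψ.relabel (Sum.map eα id)) c =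
      (letI := compatibleRingOfRing K; Nat.card {w : α → K // ψ.Realize (Sum.elim w c)}) := by
  letI := compatibleRingOfRing K
  rw [definableCard_def]
  refine Nat.card_congr ((Equiv.arrowCongr eα.symm (Equiv.refl K)).subtypeEquiv fun x => ?_)
  have hx : Sum.elim x c ∘ Sum.map eα id
      = Sum.elim ((Equiv.arrowCongr eα.symm (Equiv.refl K)) x) c := by
    funext s
    rcases s with a | b <;> rfl
  rw [Formula.realize_relabel, hx]

/-- The set variables split as `(y, z) ∈ K^m × K^k`: the point count of `ψ(y, z; c)` as a set of
pairs. [folklore] -/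
theorem natCard_realize_sum_eq_prod (K : Type*) [Add K] [Mul K] [Neg K] [One K] [Zero K]
    {m k n : ℕ} (ψ : Language.ring.Formula ((Fin m ⊕ Fin k) ⊕ Fin n)) (c : Fin n → K) :
    (letI := compatibleRingOfRing K; Nat.card {w : Fin m ⊕ Fin k → K // ψ.Realize (Sum.elim w c)})
      = (letI := compatibleRingOfRing K;
          Nat.card {p : (Fin m → K) × (Fin k → K) // ψ.Realize (Sum.elim (Sum.elim p.1 p.2) c)}) := by
  letI := compatibleRingOfRing K
  refine Nat.card_congr ((Equiv.sumArrowEquivProdArrow _ _ K).subtypeEquiv fun w => ?_)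
  have hw : Sum.elim (w ∘ Sum.inl) (w ∘ Sum.inr) = w := by
    funext s; rcases s with a | b <;> rfl
  show ψ.Realize (Sum.elim w c) ↔ ψ.Realize (Sum.elim (Sum.elim (w ∘ Sum.inl) (w ∘ Sum.inr)) c)
  rw [hw]

/-- **CDM (3.7) for one disjunct (3).** Let `Ψ(y, z; c)` be a quantifier-free ring formula
(set variables `y ∈ K^m`, auxiliary variables `z ∈ K^k`, parameters `c ∈ K^n`) with property
(4): over every finite field, for all `c, y` there are at most `e` points `z` with `Ψ(y, z; c)`.
ASSUME Lemma (3.5) (the quantifier-free case of the Main Theorem, with integer `μ ∈ {1,…,M}`).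
Then the projection `{y : ∃ z, Ψ(y, z; c)}` satisfies the CDM dichotomy for all finite fields
with `q ≥ q₁`: empty, or `| #{y : ∃ z Ψ} − μ q^d | ≤ C q^{d−1/2}` for some `(d, μ)` in a finite
set `D ⊂ {0,…,m} × ℚ_{>0}` (`q₁, C, D` depending only on `Ψ`). Proof as printed: apply (3.5)
to `Ψ` (as a formula in the `m + k` set variables `(y,z)`) and to the quantifier-free formulas
`Ψ_j(y, z^1, …, z^j; c) := ⋀_{i ≤ j} Ψ(y, z^i; c) ∧ ⋀_{i ≠ i'} z^i ≠ z^{i'}` (in `m + jk` set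
variables), `1 ≤ j ≤ e`, and feed the outputs to the counting core `cdm37_core`.
[cite: ChatzidakisVanDenDriesMacintyre1992, proof of (3.7), pp. 123–125] -/
theorem cdm37_basicFamily
    (h35 : ∀ (m n : ℕ) (ψ : Language.ring.Formula (Fin m ⊕ Fin n)), ψ.IsQF →
      ∃ (C : ℝ) (M : ℕ), ∀ (K : Type) [Field K] [Fintype K] (c : Fin n → K),
        definableCard K ψ c = 0 ∨ ∃ d μ : ℕ, (d ≤ m ∧ 1 ≤ μ ∧ μ ≤ M) ∧
          |(definableCard K ψ c : ℝ) - μ * (Fintype.card K : ℝ) ^ d|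
            ≤ C * (Fintype.card K : ℝ) ^ ((d : ℝ) - 1 / 2))
    {m k n : ℕ} (e : ℕ) (Ψ : Language.ring.Formula ((Fin m ⊕ Fin k) ⊕ Fin n)) (hΨ : Ψ.IsQF)
    (he : ∀ (K : Type) [Field K] [Fintype K] (c : Fin n → K) (y : Fin m → K),
      (letI := compatibleRingOfRing K;
        Nat.card {z : Fin k → K // Ψ.Realize (Sum.elim (Sum.elim y z) c)}) ≤ e) :
    ∃ (q₁ : ℕ) (C : ℝ) (D : Finset (ℕ × ℚ)), (∀ dμ ∈ D, dμ.1 ≤ m ∧ 0 < dμ.2) ∧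
      ∀ (K : Type) [Field K] [Fintype K] (c : Fin n → K), q₁ ≤ Fintype.card K →
        (letI := compatibleRingOfRing K;
          Nat.card {y : Fin m → K // ∃ z : Fin k → K, Ψ.Realize (Sum.elim (Sum.elim y z) c)}) = 0 ∨
        ∃ dμ ∈ D, |((letI := compatibleRingOfRing K;
            Nat.card {y : Fin m → K // ∃ z : Fin k → K, Ψ.Realize (Sum.elim (Sum.elim y z) c)}) : ℝ)
              - (dμ.2 : ℝ) * (Fintype.card K : ℝ) ^ dμ.1|
            ≤ C * (Fintype.card K : ℝ) ^ ((dμ.1 : ℝ) - 1 / 2) := by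
  classical
  /- (3.5) for `G = Ψ(·, ·; c) ⊆ K^m × K^k` -/
  obtain ⟨A, N, hA⟩ := h35 (m + k) n (Ψ.relabel (Sum.map finSumFinEquiv id))
    (isQF_formulaRelabel hΨ _)
  have hG : ∀ (K : Type) [Field K] [Fintype K] (c : Fin n → K),
      (letI := compatibleRingOfRing K;
        Nat.card {p : (Fin m → K) × (Fin k → K) // Ψ.Realize (Sum.elim (Sum.elim p.1 p.2) c)}) = 0 ∨
      ∃ d μ : ℕ, (1 ≤ μ ∧ μ ≤ N) ∧
        |((letI := compatibleRingOfRing K;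
            Nat.card {p : (Fin m → K) × (Fin k → K) //
              Ψ.Realize (Sum.elim (Sum.elim p.1 p.2) c)}) : ℝ) - μ * (Fintype.card K : ℝ) ^ d|
          ≤ A * (Fintype.card K : ℝ) ^ ((d : ℝ) - 1 / 2) := by
    intro K _ _ c
    have h := hA K c
    rw [definableCard_relabel_equiv, natCard_realize_sum_eq_prod] at h
    exact h.imp_right fun ⟨d, μ, ⟨_, h1, h2⟩, h3⟩ => ⟨d, μ, ⟨h1, h2⟩, h3⟩
  /- (3.5) for the `H_j = Ψ_j(·; c) ⊆ K^m × (K^k)^j` -/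
  have hH : ∀ j : ℕ, ∃ (A' : ℝ) (M' : ℕ), ∀ (K : Type) [Field K] [Fintype K] (c : Fin n → K),
      (letI := compatibleRingOfRing K;
        Nat.card {p : (Fin m → K) × (Fin j → Fin k → K) //
          (∀ i, Ψ.Realize (Sum.elim (Sum.elim p.1 (p.2 i)) c)) ∧ Function.Injective p.2}) = 0 ∨
      ∃ d μ : ℕ, (1 ≤ μ ∧ μ ≤ M') ∧
        |((letI := compatibleRingOfRing K;
            Nat.card {p : (Fin m → K) × (Fin j → Fin k → K) //
              (∀ i, Ψ.Realize (Sum.elim (Sum.elim p.1 (p.2 i)) c)) ∧ Function.Injective p.2}) : ℝ)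
            - μ * (Fintype.card K : ℝ) ^ d|
          ≤ A' * (Fintype.card K : ℝ) ^ ((d : ℝ) - 1 / 2) := by
    intro j
    -- the formula `Ψ_j(y, z^1, …, z^j; c)`: set variables `Fin m ⊕ (Fin j × Fin k)`
    let ΨJ : Language.ring.Formula ((Fin m ⊕ (Fin j × Fin k)) ⊕ Fin n) :=
      (BoundedFormula.iInf fun i : Fin j =>
          Ψ.relabel (Sum.map (Sum.map id fun l : Fin k => (i, l)) id)) ⊓
        BoundedFormula.iInf fun pr : {pr : Fin j × Fin j // pr.1 ≠ pr.2} =>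
          ∼(BoundedFormula.iInf fun l : Fin k =>
              Term.equal (var (Sum.inl (Sum.inr (pr.1.1, l))))
                (var (Sum.inl (Sum.inr (pr.1.2, l)))))
    have hQF : ΨJ.IsQF := by
      refine (isQF_iInf fun i => isQF_formulaRelabel hΨ _).inf (isQF_iInf fun pr => ?_)
      exact (isQF_iInf fun l => (IsAtomic.equal _ _).isQF).not
    -- its realizations
    have hreal : ∀ (K : Type) [Field K] (c : Fin n → K) (w : Fin m ⊕ (Fin j × Fin k) → K),
        (letI := compatibleRingOfRing K; ΨJ.Realize (Sum.elim w c)) ↔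
          (letI := compatibleRingOfRing K;
            (∀ i, Ψ.Realize (Sum.elim (Sum.elim (w ∘ Sum.inl) fun l => w (Sum.inr (i, l))) c)) ∧
              Function.Injective fun i l => w (Sum.inr (i, l))) := by
      intro K _ c w
      letI := compatibleRingOfRing K
      have hwi : ∀ i : Fin j, Sum.elim w c ∘ Sum.map (Sum.map id fun l : Fin k => (i, l)) id
          = Sum.elim (Sum.elim (w ∘ Sum.inl) fun l => w (Sum.inr (i, l))) c := by
        intro i
        funext s
        rcases s with ((a | l) | b) <;> rfl
      simp only [ΨJ, Formula.realize_inf]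
      refine and_congr ?_ ?_
      · change (BoundedFormula.iInf _).Realize (Sum.elim w c) default ↔ _
        rw [realize_iInf]
        refine forall_congr' fun i => ?_
        change (Formula.relabel _ Ψ).Realize (Sum.elim w c) ↔ _
        rw [Formula.realize_relabel, hwi]
      · change (BoundedFormula.iInf _).Realize (Sum.elim w c) default ↔ _
        rw [realize_iInf]
        constructor
        · intro hall i i' hii'
          by_contra hne
          have h := hall ⟨(i, i'), hne⟩
          rw [realize_not] at h
          apply h
          rw [realize_iInf]
          intro l
          change (Term.equal _ _).Realize (Sum.elim w c)
          rw [Formula.realize_equal]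
          simpa using congrFun hii' l
        · intro hinj pr
          rw [realize_not]
          intro hall
          apply pr.2
          apply hinj
          funext l
          have h := (show (BoundedFormula.iInf _).Realize (Sum.elim w c) default from hall)
          rw [realize_iInf] at h
          have hl := h l
          change (Term.equal _ _).Realize (Sum.elim w c) at hl
          rw [Formula.realize_equal] at hl
          simpa using hl
    -- relabel to `Fin (m + j k)` set variables and apply (3.5)
    let eJ : Fin m ⊕ (Fin j × Fin k) ≃ Fin (m + j * k) :=
      (Equiv.sumCongr (Equiv.refl _) finProdFinEquiv).trans finSumFinEquiv
    obtain ⟨A', M', h⟩ := h35 (m + j * k) n (ΨJ.relabel (Sum.map eJ id))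
      (isQF_formulaRelabel hQF _)
    refine ⟨A', M', fun K _ _ c => ?_⟩
    letI := compatibleRingOfRing K
    have hcard : definableCard K (ΨJ.relabel (Sum.map eJ id)) c =
        Nat.card {p : (Fin m → K) × (Fin j → Fin k → K) //
          (∀ i, Ψ.Realize (Sum.elim (Sum.elim p.1 (p.2 i)) c)) ∧ Function.Injective p.2} := by
      rw [definableCard_relabel_equiv]
      refine Nat.card_congr
        { toFun := fun w => ⟨(w.1 ∘ Sum.inl, fun i l => w.1 (Sum.inr (i, l))),
            (hreal K c w.1).1 w.2⟩
          invFun := fun p => ⟨Sum.elim p.1.1 fun il => p.1.2 il.1 il.2, (hreal K c _).2 (by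
            simpa using p.2)⟩
          left_inv := fun w => by
            apply Subtype.ext
            funext s
            rcases s with a | ⟨i, l⟩ <;> rfl
          right_inv := fun p => rfl }
    have h' := h K c
    rw [hcard] at h'
    exact h'.imp_right fun ⟨d, μ, ⟨_, h1, h2⟩, h3⟩ => ⟨d, μ, ⟨h1, h2⟩, h3⟩
  choose A' M' hA' using hH
  /- the counting core -/
  obtain ⟨q₁, C, R, hRpos, hcore⟩ := cdm37_core e m N A M' A'
  refine ⟨⌈q₁⌉₊, C, (Finset.range (m + 1)) ×ˢ R, ?_, ?_⟩
  · intro dμ hdμ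
    rw [Finset.mem_product, Finset.mem_range] at hdμ
    exact ⟨Nat.lt_succ_iff.1 hdμ.1, hRpos _ hdμ.2⟩
  · intro K _ _ c hq
    letI := compatibleRingOfRing K
    have hq' : q₁ ≤ (Fintype.card K : ℝ) := (Nat.le_ceil q₁).trans (by exact_mod_cast hq)
    have hY : (Nat.card (Fin m → K) : ℝ) ≤ (Fintype.card K : ℝ) ^ m := by
      rw [Nat.card_eq_fintype_card, Fintype.card_fun, Fintype.card_fin]
      push_cast
      exact le_rfl
    rcases hcore (Fintype.card K : ℝ) hq' (Fin m → K) (Fin k → K)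
        (fun y z => Ψ.Realize (Sum.elim (Sum.elim y z) c)) (he K c) hY (hG K c)
        (fun j _ _ => hA' j K c) with h0 | ⟨d, hd, ρ, hρ, hest⟩
    · exact Or.inl h0
    · exact Or.inr ⟨(d, ρ), Finset.mem_product.2 ⟨Finset.mem_range.2 (Nat.lt_succ_of_le hd), hρ⟩,
        hest⟩

end CDM37Syntax


/-! ## The Main Theorem from Lemma (3.5) and the normal form (3)–(4) -/

section CDM37Assembly

open FirstOrder FirstOrder.Language FirstOrder.Ring BoundedFormula

/-- **CDM Main Theorem (3.7), from its two printed inputs.** ASSUME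
(i) Lemma (3.5): the Main Theorem for quantifier-free formulas, with integer measures
`μ ∈ {1,…,M}` (proved in the paper from Prop. (3.3), the Lang–Weil estimate for arbitrary
`k`-algebraic sets, itself from Lang–Weil [10] and the bounds (1.7)); and
(ii) the normal form to which the paper reduces on p. 123 ("Therefore we may reduce to the
following situation"), obtained there from the positive quantifier elimination (2.7) for
enriched finite fields by the distributive law: for every ring formula `φ(y; c)` there are
`q₀`, finitely many quantifier-free formulas `Ψ_ν(y, z; c')` (disjuncts (3):
`f(X,Y) = 0 ∧ ∃ Z ⋀_j h_j(X,Y,Z_j) = 0`, with the enrichment constants `c_i` replaced by extra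
parameters, whence parameters `c' ∈ K^{n'}` chosen per field and per `c`) with property (4)
(at most `e_ν` witnesses `z`), such that in every finite field with `q ≥ q₀` the set `φ(K^m; c)`
is the DISJOINT union of the projections `{y : ∃ z, Ψ_ν(y, z; c')}`.
THEN the Main Theorem `ChatzidakisVanDenDriesMacintyre1992_mainTheorem` holds.
Proof: `cdm37_basicFamily` for each disjunct, `cdmEstimate_sum` for the disjoint union, and
`ChatzidakisVanDenDriesMacintyre1992_mainTheorem_of_eventually` for the finitely many small `q`
("It suffices to prove the Main Theorem for `q` greater than some constant depending only on
`φ`", Remark before the proof of (3.7)).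
[cite: ChatzidakisVanDenDriesMacintyre1992, (3.7) and its proof, pp. 122–125] -/
theorem mainTheorem_of_qf_of_decomposition
    (h35 : ∀ (m n : ℕ) (ψ : Language.ring.Formula (Fin m ⊕ Fin n)), ψ.IsQF →
      ∃ (C : ℝ) (M : ℕ), ∀ (K : Type) [Field K] [Fintype K] (c : Fin n → K),
        definableCard K ψ c = 0 ∨ ∃ d μ : ℕ, (d ≤ m ∧ 1 ≤ μ ∧ μ ≤ M) ∧
          |(definableCard K ψ c : ℝ) - μ * (Fintype.card K : ℝ) ^ d|
            ≤ C * (Fintype.card K : ℝ) ^ ((d : ℝ) - 1 / 2))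
    (hdec : ∀ (m n : ℕ) (φ : Language.ring.Formula (Fin m ⊕ Fin n)),
      ∃ (q₀ n' s : ℕ) (k e : Fin s → ℕ)
        (Ψ : ∀ i : Fin s, Language.ring.Formula ((Fin m ⊕ Fin (k i)) ⊕ Fin n')),
        (∀ i, (Ψ i).IsQF) ∧
        (∀ i (K : Type) [Field K] [Fintype K] (c' : Fin n' → K) (y : Fin m → K),
          (letI := compatibleRingOfRing K;
            Nat.card {z : Fin (k i) → K // (Ψ i).Realize (Sum.elim (Sum.elim y z) c')}) ≤ e i) ∧
        ∀ (K : Type) [Field K] [Fintype K], q₀ ≤ Fintype.card K → ∀ (c : Fin n → K),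
          ∃ c' : Fin n' → K, ∀ y : Fin m → K,
            (letI := compatibleRingOfRing K;
              (φ.Realize (Sum.elim y c) ↔
                  ∃ i, ∃ z : Fin (k i) → K, (Ψ i).Realize (Sum.elim (Sum.elim y z) c')) ∧
                ∀ i i', i ≠ i' → (∃ z : Fin (k i) → K, (Ψ i).Realize (Sum.elim (Sum.elim y z) c')) →
                  ¬∃ z : Fin (k i') → K, (Ψ i').Realize (Sum.elim (Sum.elim y z) c'))) :
    ChatzidakisVanDenDriesMacintyre1992_mainTheorem := by
  classical
  apply ChatzidakisVanDenDriesMacintyre1992_mainTheorem_of_eventually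
  intro m n φ
  obtain ⟨q₀, n', s, k, e, Ψ, hQF, he, hφ⟩ := hdec m n φ
  -- the estimate for each disjunct
  have hbasic := fun i : Fin s => cdm37_basicFamily h35 (e i) (Ψ i) (hQF i) (he i)
  choose q₁ C D hD hest using hbasic
  -- add them up
  obtain ⟨C', D', hD', hsum⟩ := cdmEstimate_sum m C D hD
  refine ⟨max q₀ (Finset.univ.sup q₁), C', D', hD', ?_⟩
  intro K _ _ c hq
  letI := compatibleRingOfRing K
  have hq0 : q₀ ≤ Fintype.card K := le_trans (le_max_left _ _) hq
  have hqi : ∀ i, q₁ i ≤ Fintype.card K := fun i =>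
    le_trans (le_trans (Finset.le_sup (f := q₁) (Finset.mem_univ i)) (le_max_right _ _)) hq
  obtain ⟨c', hc'⟩ := hφ K hq0 c
  -- `|φ(K^m; c)| = ∑_ν |{y : ∃ z, Ψ_ν(y, z; c')}|`
  have hcard : definableCard K φ c = ∑ i, Nat.card {y : Fin m → K //
      ∃ z : Fin (k i) → K, (Ψ i).Realize (Sum.elim (Sum.elim y z) c')} := by
    rw [definableCard_eq_card_filter]
    have hset : (Finset.univ.filter fun y : Fin m → K => φ.Realize (Sum.elim y c))
        = Finset.univ.biUnion fun i => Finset.univ.filter fun y : Fin m → K =>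
            ∃ z : Fin (k i) → K, (Ψ i).Realize (Sum.elim (Sum.elim y z) c') := by
      ext y
      simp only [Finset.mem_filter, Finset.mem_univ, true_and, Finset.mem_biUnion]
      exact (hc' y).1
    have hdisj : ∀ i ∈ (Finset.univ : Finset (Fin s)), ∀ i' ∈ (Finset.univ : Finset (Fin s)),
        i ≠ i' → Disjoint
          (Finset.univ.filter fun y : Fin m → K =>
            ∃ z : Fin (k i) → K, (Ψ i).Realize (Sum.elim (Sum.elim y z) c'))
          (Finset.univ.filter fun y : Fin m → K =>
            ∃ z : Fin (k i') → K, (Ψ i').Realize (Sum.elim (Sum.elim y z) c')) := by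
      intro i _ i' _ hii'
      rw [Finset.disjoint_left]
      intro y hy hy'
      simp only [Finset.mem_filter, Finset.mem_univ, true_and] at hy hy'
      exact (hc' y).2 i i' hii' hy hy'
    convert (congrArg Finset.card hset).trans (Finset.card_biUnion hdisj) using 1
    refine Finset.sum_congr rfl fun i _ => ?_
    rw [Nat.card_eq_fintype_card, Fintype.card_subtype]
  have hq1 : (1 : ℝ) ≤ Fintype.card K := by exact_mod_cast Fintype.card_pos
  have H := hsum (Fintype.card K : ℝ) hq1
    (fun i => Nat.card {y : Fin m → K //
      ∃ z : Fin (k i) → K, (Ψ i).Realize (Sum.elim (Sum.elim y z) c')})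
    (fun i => hest i K c' (hqi i))
  rw [hcard]
  exact H

end CDM37Assembly

end CDM37

/-! ## Lemma (3.5) from Proposition (3.3) (CDM 1992, p. 122) -/

section Lemma35

open FirstOrder FirstOrder.Language FirstOrder.Ring BoundedFormula Finset

/-! ### Quantifier-free ring formulas: atoms and Boolean skeleton -/

/-- A quantifier-free formula of the language of rings is a Boolean combination of finitely many
polynomial equations `τ₁ = τ₂` between ring terms: there are finitely many pairs of terms and a
Boolean skeleton `B` such that in every ring the formula holds iff `B` holds of the truth values
of the equations. (Induction on `IsQF`; the ring language has no relation symbols.) [folklore] -/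
theorem exists_atoms_of_isQF {α : Type*} {ψ : Language.ring.Formula α} (hψ : ψ.IsQF) :
    ∃ (s : ℕ) (τ₁ τ₂ : Fin s → Language.ring.Term (α ⊕ Fin 0)) (B : (Fin s → Prop) → Prop),
      ∀ (K : Type) [CommRing K] (v : α → K),
        (letI := compatibleRingOfRing K;
          (ψ.Realize v ↔
            B fun i => (τ₁ i).realize (Sum.elim v default) = (τ₂ i).realize (Sum.elim v default))) := by
  induction hψ with
  | falsum =>
    exact ⟨0, Fin.elim0, Fin.elim0, fun _ => False, fun K _ v => Iff.rfl⟩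
  | of_isAtomic h =>
    cases h with
    | equal t₁ t₂ =>
      exact ⟨1, fun _ => t₁, fun _ => t₂, fun P => P 0, fun K _ v => Iff.rfl⟩
    | rel R ts => exact R.elim
  | imp h₁ h₂ ih₁ ih₂ =>
    obtain ⟨s₁, a₁, b₁, B₁, h₁'⟩ := ih₁
    obtain ⟨s₂, a₂, b₂, B₂, h₂'⟩ := ih₂
    refine ⟨s₁ + s₂, Fin.append a₁ a₂, Fin.append b₁ b₂,
      fun P => B₁ (fun i => P (Fin.castAdd s₂ i)) → B₂ (fun i => P (Fin.natAdd s₁ i)),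
      fun K _ v => ?_⟩
    letI := compatibleRingOfRing K
    have e1 := h₁' K v
    have e2 := h₂' K v
    simp only [Fin.append_left, Fin.append_right]
    exact imp_congr e1 e2

/-! ### Ring terms with parameters are polynomials of bounded degree -/

/-- A ring term `t(x, c)` in set variables `x ∈ K^m` and parameter variables, once the
parameters are specialised to `c ∈ K^n`, is (the evaluation of) a polynomial over `K` in the
set variables whose total degree is bounded in terms of `t` alone. [folklore] -/
theorem exists_mvPolynomial_of_term {m n : ℕ}
    (t : Language.ring.Term ((Fin m ⊕ Fin n) ⊕ Fin 0)) :
    ∃ D : ℕ, ∀ (K : Type) [Field K] (c : Fin n → K), ∃ P : MvPolynomial (Fin m) K,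
      P.totalDegree ≤ D ∧ ∀ x : Fin m → K,
        MvPolynomial.eval x P =
          (letI := compatibleRingOfRing K; t.realize (Sum.elim (Sum.elim x c) default)) := by
  induction t with
  | var a =>
    rcases a with (i | j) | o
    · refine ⟨1, fun K _ c => ⟨MvPolynomial.X i, (MvPolynomial.totalDegree_X i).le, fun x => ?_⟩⟩
      simp [Term.realize]
    · refine ⟨0, fun K _ c => ⟨MvPolynomial.C (c j), (MvPolynomial.totalDegree_C _).le, fun x => ?_⟩⟩
      simp [Term.realize]
    · exact o.elim0
  | func f ts ih =>
    choose D hD using ih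
    cases f with
    | add =>
      refine ⟨max (D 0) (D 1), fun K _ c => ?_⟩
      obtain ⟨P₀, hP₀, hP₀e⟩ := hD 0 K c
      obtain ⟨P₁, hP₁, hP₁e⟩ := hD 1 K c
      refine ⟨P₀ + P₁, (MvPolynomial.totalDegree_add _ _).trans (max_le_max hP₀ hP₁), fun x => ?_⟩
      letI := compatibleRingOfRing K
      simp only [map_add, hP₀e, hP₁e, Term.realize, CompatibleRing.funMap_add]
    | mul =>
      refine ⟨D 0 + D 1, fun K _ c => ?_⟩
      obtain ⟨P₀, hP₀, hP₀e⟩ := hD 0 K c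
      obtain ⟨P₁, hP₁, hP₁e⟩ := hD 1 K c
      refine ⟨P₀ * P₁, (MvPolynomial.totalDegree_mul _ _).trans (add_le_add hP₀ hP₁), fun x => ?_⟩
      letI := compatibleRingOfRing K
      simp only [map_mul, hP₀e, hP₁e, Term.realize, CompatibleRing.funMap_mul]
    | neg =>
      refine ⟨D 0, fun K _ c => ?_⟩
      obtain ⟨P₀, hP₀, hP₀e⟩ := hD 0 K c
      refine ⟨-P₀, (MvPolynomial.totalDegree_neg _).le.trans hP₀, fun x => ?_⟩
      letI := compatibleRingOfRing K
      simp only [map_neg, hP₀e, Term.realize, CompatibleRing.funMap_neg]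
    | zero =>
      refine ⟨0, fun K _ c => ⟨0, by simp, fun x => ?_⟩⟩
      letI := compatibleRingOfRing K
      simp [Term.realize]
    | one =>
      refine ⟨0, fun K _ c => ⟨1, by simp, fun x => ?_⟩⟩
      letI := compatibleRingOfRing K
      simp [Term.realize]

/-! ### A disjunction of systems of equations is one system (over a domain) -/

/-- Over a domain, "some system `E_ν` vanishes" iff "every product `∏_ν E_ν(j_ν)` over choice
functions vanishes": the distributive law that turns the positive quantifier-free formula `φ'`
of the proof of (3.5) into a conjunction of polynomial equations.
[cite: ChatzidakisVanDenDriesMacintyre1992, proof of (3.5), p. 122] -/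
theorem exists_forall_eq_zero_iff_forall_prod {K : Type*} [CommRing K] [IsDomain K]
    {Λ J : Type*} [Fintype Λ] (E : Λ → J → K) :
    (∃ ν, ∀ j, E ν j = 0) ↔ ∀ g : Λ → J, ∏ ν, E ν (g ν) = 0 := by
  constructor
  · rintro ⟨ν, hν⟩ g
    exact prod_eq_zero (mem_univ ν) (hν (g ν))
  · intro h
    by_contra hne
    push Not at hne
    choose g hg using hne
    exact (prod_ne_zero_iff.2 fun ν _ => hg ν) (h g)


/-! ### Lemma (3.5) from Proposition (3.3) -/

/-- **CDM Lemma (3.5) from Proposition (3.3).** ASSUME (3.3) in the dimension-free form: for all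
`(N, r, e)` there are `C` and `M ∈ ℕ` such that for every finite field `K` and every
`f = (f_1,…,f_r)`, `f_l ∈ K[Z_1,…,Z_N]` of total degree `≤ e`, the set `V(K) = {z : f(z) = 0}`
is empty or `| |V(K)| − μ q^d | ≤ C q^{d−1/2}` for some `d ≤ N`, `μ ∈ {1,…,M}`. THEN the same
holds for the sets `φ(K^m; c)` defined by a quantifier-free ring formula `φ(x; y)`, uniformly in
the parameters `c`, with `d ≤ m`. Proof as printed (p. 122): write `φ` as a disjunction of
pairwise disjoint conjunctions `f_ν = 0 ∧ g_ν ≠ 0` (here: the sign patterns `ν` of the atoms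
`τ₁ = τ₂` of `φ`, `exists_atoms_of_isQF`; the terms are polynomials of bounded degree once the
parameters are specialised, `exists_mvPolynomial_of_term`); the positive quantifier-free formula
`φ' := ⋁_ν (f_ν = 0 ∧ g_ν · Y'_ν = 1 ∧ ⋀_{λ ≠ ν} Y'_λ = 0)` in the variables `(x, Y') ∈ K^m × K^Λ`
is, over a field, a conjunction of polynomial equations (`exists_forall_eq_zero_iff_forall_prod`),
and `(x, y') ↦ x` is a bijection `φ'(K^{m+Λ}) → φ(K^m; c)`; apply (3.3) to `φ'`. The printed proof
bounds `d` by `dim φ' ≤ m`; with the dimension-free hypothesis we get `d ≤ m` instead from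
`|φ(K^m;c)| ≤ q^m` for `q ≥ (|C|+1)²`, and treat the finitely many smaller `q` by the pairs
`(0, |φ(K^m;c)|)` (integer measures `≤ Q^m`).
[cite: ChatzidakisVanDenDriesMacintyre1992, Lemma (3.5) and its proof, p. 122] -/
theorem lemma35_of_prop33
    (h33 : ∀ (N r e : ℕ), ∃ (C : ℝ) (M : ℕ), ∀ (K : Type) [Field K] [Fintype K]
      (f : Fin r → MvPolynomial (Fin N) K), (∀ l, (f l).totalDegree ≤ e) →
        Nat.card {z : Fin N → K // ∀ l, MvPolynomial.eval z (f l) = 0} = 0 ∨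
        ∃ d μ : ℕ, (d ≤ N ∧ 1 ≤ μ ∧ μ ≤ M) ∧
          |(Nat.card {z : Fin N → K // ∀ l, MvPolynomial.eval z (f l) = 0} : ℝ)
              - μ * (Fintype.card K : ℝ) ^ d|
            ≤ C * (Fintype.card K : ℝ) ^ ((d : ℝ) - 1 / 2))
    (m n : ℕ) (ψ : Language.ring.Formula (Fin m ⊕ Fin n)) (hψ : ψ.IsQF) :
    ∃ (C : ℝ) (M : ℕ), ∀ (K : Type) [Field K] [Fintype K] (c : Fin n → K),
      definableCard K ψ c = 0 ∨ ∃ d μ : ℕ, (d ≤ m ∧ 1 ≤ μ ∧ μ ≤ M) ∧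
        |(definableCard K ψ c : ℝ) - μ * (Fintype.card K : ℝ) ^ d|
          ≤ C * (Fintype.card K : ℝ) ^ ((d : ℝ) - 1 / 2) := by
  classical
  obtain ⟨s, τ₁, τ₂, B, hB⟩ := exists_atoms_of_isQF hψ
  -- degree bounds for the atom polynomials, uniform in the field and the parameters
  have hP := fun i => exists_mvPolynomial_of_term (τ₁ i)
  have hQ := fun i => exists_mvPolynomial_of_term (τ₂ i)
  choose D₁ hD₁ using hP
  choose D₂ hD₂ using hQ
  set Dm : ℕ := univ.sup fun i => max (D₁ i) (D₂ i) with hDm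
  have hDm1 : ∀ i, D₁ i ≤ Dm := fun i =>
    le_trans (le_max_left _ _) (le_sup (f := fun i => max (D₁ i) (D₂ i)) (mem_univ i))
  have hDm2 : ∀ i, D₂ i ≤ Dm := fun i =>
    le_trans (le_max_right _ _) (le_sup (f := fun i => max (D₁ i) (D₂ i)) (mem_univ i))
  -- sizes of the data of the variety `φ'`: variables `Fin m ⊕ Λ`, equations indexed by `Λ → J`
  set N : ℕ := m + Fintype.card (Fin s → Bool) with hN
  set r : ℕ := Fintype.card ((Fin s → Bool) → (Fin s ⊕ Option (Fin s → Bool))) with hr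
  set e : ℕ := Fintype.card (Fin s → Bool) * (s * Dm + 1) with he
  obtain ⟨C, M, h⟩ := h33 N r e
  set Q : ℕ := ⌈(|C| + 1) ^ 2⌉₊ + 2 with hQ
  refine ⟨max C 0, max M (Q ^ m), fun K _ _ c => ?_⟩
  letI := compatibleRingOfRing K
  /- the atom polynomials `a_i(x) = τ₁ᵢ(x,c) − τ₂ᵢ(x,c)` over `K` -/
  have hA : ∀ i, ∃ A : MvPolynomial (Fin m) K, A.totalDegree ≤ Dm ∧ ∀ x : Fin m → K,
      MvPolynomial.eval x A = (τ₁ i).realize (Sum.elim (Sum.elim x c) default)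
        - (τ₂ i).realize (Sum.elim (Sum.elim x c) default) := by
    intro i
    obtain ⟨P₁, hP₁, hP₁e⟩ := hD₁ i K c
    obtain ⟨P₂, hP₂, hP₂e⟩ := hD₂ i K c
    refine ⟨P₁ - P₂, (MvPolynomial.totalDegree_sub _ _).trans (max_le ((hP₁).trans (hDm1 i))
      ((hP₂).trans (hDm2 i))), fun x => ?_⟩
    rw [map_sub, hP₁e, hP₂e]
  choose A hAdeg hAeval using hA
  -- the set to count, in terms of the atom polynomials
  have hcount : definableCard K ψ c
      = Nat.card {x : Fin m → K // B fun i => MvPolynomial.eval x (A i) = 0} := by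
    rw [definableCard_def]
    refine Nat.card_congr (Equiv.subtypeEquivRight fun x => ?_)
    rw [hB K (Sum.elim x c)]
    have hfun : (fun i => (τ₁ i).realize (Sum.elim (Sum.elim x c) default)
        = (τ₂ i).realize (Sum.elim (Sum.elim x c) default))
        = fun i => MvPolynomial.eval x (A i) = 0 := by
      funext i
      rw [hAeval, sub_eq_zero]
    rw [hfun]
  /- the variety `φ'` -/
  -- lifted atom polynomials, the products `g_ν`, the systems `E_ν`, and the equations `F`
  let A' : Fin s → MvPolynomial (Fin m ⊕ (Fin s → Bool)) K := fun i =>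
    MvPolynomial.rename Sum.inl (A i)
  let g : (Fin s → Bool) → MvPolynomial (Fin m ⊕ (Fin s → Bool)) K := fun ν =>
    ∏ i ∈ univ.filter (fun i => ν i = false), A' i
  let E : (Fin s → Bool) → (Fin s ⊕ Option (Fin s → Bool)) →
      MvPolynomial (Fin m ⊕ (Fin s → Bool)) K := fun ν j =>
    if B (fun i => ν i = true) then
      Sum.elim (fun i => if ν i = true then A' i else 0)
        (fun o => o.elim (g ν * MvPolynomial.X (Sum.inr ν) - 1)
          (fun l => if l = ν then 0 else MvPolynomial.X (Sum.inr l))) j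
    else 1
  let F : ((Fin s → Bool) → (Fin s ⊕ Option (Fin s → Bool))) →
      MvPolynomial (Fin m ⊕ (Fin s → Bool)) K := fun G => ∏ ν, E ν (G ν)
  let eσ : Fin m ⊕ (Fin s → Bool) ≃ Fin N :=
    (Equiv.sumCongr (Equiv.refl _) (Fintype.equivFin _)).trans finSumFinEquiv
  let eG : ((Fin s → Bool) → (Fin s ⊕ Option (Fin s → Bool))) ≃ Fin r := Fintype.equivFin _
  let f : Fin r → MvPolynomial (Fin N) K := fun l => MvPolynomial.rename eσ (F (eG.symm l))
  /- degrees -/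
  have hA'deg : ∀ i, (A' i).totalDegree ≤ Dm := fun i =>
    (MvPolynomial.totalDegree_rename_le _ _).trans (hAdeg i)
  have hgdeg : ∀ ν, (g ν).totalDegree ≤ s * Dm := by
    intro ν
    refine (MvPolynomial.totalDegree_finsetProd _ _).trans ?_
    refine (sum_le_card_nsmul _ _ _ fun i _ => hA'deg i).trans ?_
    rw [smul_eq_mul]
    exact Nat.mul_le_mul_right _ ((card_le_univ _).trans (by simp))
  have hEdeg : ∀ ν j, (E ν j).totalDegree ≤ s * Dm + 1 := by
    intro ν j
    simp only [E]
    split_ifs with hb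
    · rcases j with i | (_ | l)
      · simp only [Sum.elim_inl]
        split_ifs
        · exact (hA'deg i).trans ((Nat.le_mul_of_pos_left Dm (Fin.pos i)).trans (Nat.le_succ _))
        · simp
      · simp only [Sum.elim_inr, Option.elim]
        refine (MvPolynomial.totalDegree_sub _ _).trans (max_le ?_ (by simp))
        refine (MvPolynomial.totalDegree_mul _ _).trans ?_
        exact add_le_add (hgdeg ν) (MvPolynomial.totalDegree_X _).le
      · simp only [Sum.elim_inr, Option.elim]
        split_ifs
        · simp
        · exact (MvPolynomial.totalDegree_X _).le.trans (Nat.le_add_left _ _)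
    · simp
  have hFdeg : ∀ G, (F G).totalDegree ≤ e := by
    intro G
    refine (MvPolynomial.totalDegree_finsetProd _ _).trans ?_
    refine (sum_le_card_nsmul _ _ _ fun ν _ => hEdeg ν (G ν)).trans ?_
    rw [smul_eq_mul, card_univ]
  have hfdeg : ∀ l, (f l).totalDegree ≤ e := fun l =>
    (MvPolynomial.totalDegree_rename_le _ _).trans (hFdeg _)
  /- semantics of the variety -/
  let gx : (Fin s → Bool) → (Fin m → K) → K := fun ν x =>
    ∏ i ∈ univ.filter (fun i => ν i = false), MvPolynomial.eval x (A i)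
  have hevalA' : ∀ i (w : Fin m ⊕ (Fin s → Bool) → K),
      MvPolynomial.eval w (A' i) = MvPolynomial.eval (w ∘ Sum.inl) (A i) := fun i w => by
    simp only [A', MvPolynomial.eval_rename]
  have hgx : ∀ ν (w : Fin m ⊕ (Fin s → Bool) → K),
      MvPolynomial.eval w (g ν) = gx ν (w ∘ Sum.inl) := fun ν w => by
    simp only [g, gx, map_prod, hevalA']
  -- membership in `φ'(K^{m+Λ})`
  have hmem : ∀ w : Fin m ⊕ (Fin s → Bool) → K,
      (∀ G, MvPolynomial.eval w (F G) = 0) ↔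
        ∃ ν : Fin s → Bool, B (fun i => ν i = true) ∧
          (∀ i, ν i = true → MvPolynomial.eval (w ∘ Sum.inl) (A i) = 0) ∧
          gx ν (w ∘ Sum.inl) * w (Sum.inr ν) = 1 ∧
          ∀ l, l ≠ ν → w (Sum.inr l) = 0 := by
    intro w
    have hF : ∀ G, MvPolynomial.eval w (F G) = ∏ ν, MvPolynomial.eval w (E ν (G ν)) :=
      fun G => by simp only [F, map_prod]
    simp only [hF]
    rw [← exists_forall_eq_zero_iff_forall_prod (fun ν j => MvPolynomial.eval w (E ν j))]
    refine exists_congr fun ν => ?_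
    by_cases hb : B (fun i => ν i = true)
    · simp only [E, if_pos hb]
      constructor
      · intro hall
        refine ⟨hb, fun i hi => ?_, ?_, fun l hl => ?_⟩
        · have h1 := hall (Sum.inl i)
          simp only [Sum.elim_inl, if_pos hi, hevalA'] at h1
          exact h1
        · have h1 := hall (Sum.inr none)
          simp only [Sum.elim_inr, Option.elim, map_sub, map_mul, hgx, MvPolynomial.eval_X,
            map_one] at h1
          exact sub_eq_zero.1 h1
        · have h1 := hall (Sum.inr (some l))
          simp only [Sum.elim_inr, Option.elim, if_neg hl, MvPolynomial.eval_X] at h1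
          exact h1
      · rintro ⟨-, hpos, hg, hzero⟩ j
        rcases j with i | (_ | l)
        · simp only [Sum.elim_inl]
          split_ifs with hi
          · rw [hevalA']
            exact hpos i hi
          · simp
        · simp only [Sum.elim_inr, Option.elim, map_sub, map_mul, hgx, MvPolynomial.eval_X,
            map_one]
          exact sub_eq_zero.2 hg
        · simp only [Sum.elim_inr, Option.elim]
          split_ifs with hl
          · simp
          · rw [MvPolynomial.eval_X]
            exact hzero l hl
    · simp only [E, if_neg hb, map_one, one_ne_zero]
      constructor
      · intro h1
        exact (h1 (Sum.inr none)).elim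
      · rintro ⟨h1, -⟩
        exact absurd h1 hb
  -- sign patterns are determined by the point
  have hkey : ∀ (x : Fin m → K) (ν : Fin s → Bool),
      (∀ i, ν i = true → MvPolynomial.eval x (A i) = 0) → gx ν x ≠ 0 →
      (fun i => MvPolynomial.eval x (A i) = 0) = fun i => ν i = true := by
    intro x ν hpos hg
    funext i
    apply propext
    constructor
    · intro h0
      by_contra hne
      have hf : ν i = false := by simpa using hne
      exact (prod_ne_zero_iff.1 hg i (mem_filter.2 ⟨mem_univ _, hf⟩)) h0
    · exact hpos i
  -- the projection `(x, y') ↦ x` is a bijection `φ'(K^{m+Λ}) → φ(K^m; c)`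
  have hcardV : Nat.card {w : Fin m ⊕ (Fin s → Bool) → K // ∀ G, MvPolynomial.eval w (F G) = 0}
      = Nat.card {x : Fin m → K // B fun i => MvPolynomial.eval x (A i) = 0} := by
    refine Nat.card_congr (Equiv.ofBijective
      (fun w => ⟨w.1 ∘ Sum.inl, ?_⟩) ⟨?_, ?_⟩)
    · obtain ⟨ν, hb, hpos, hg, -⟩ := (hmem w.1).1 w.2
      rw [hkey _ ν hpos (left_ne_zero_of_mul_eq_one hg)]
      exact hb
    · rintro ⟨w₁, hw₁⟩ ⟨w₂, hw₂⟩ hx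
      simp only [Subtype.mk.injEq] at hx ⊢
      obtain ⟨ν₁, -, hpos₁, hg₁, hz₁⟩ := (hmem w₁).1 hw₁
      obtain ⟨ν₂, -, hpos₂, hg₂, hz₂⟩ := (hmem w₂).1 hw₂
      have hν : ν₁ = ν₂ := by
        have e1 := hkey _ ν₁ hpos₁ (left_ne_zero_of_mul_eq_one hg₁)
        have e2 := hkey _ ν₂ hpos₂ (left_ne_zero_of_mul_eq_one hg₂)
        rw [hx] at e1
        have e3 := e1.symm.trans e2
        funext i
        exact Bool.eq_iff_iff.2 (iff_of_eq (congrFun e3 i))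
      subst hν
      rw [hx] at hg₁
      funext v
      rcases v with i | l
      · exact congrFun hx i
      · by_cases hl : l = ν₁
        · subst hl
          exact mul_left_cancel₀ (left_ne_zero_of_mul_eq_one hg₂) (hg₁.trans hg₂.symm)
        · rw [hz₁ l hl, hz₂ l hl]
    · rintro ⟨x, hx⟩
      let ν : Fin s → Bool := fun i => decide (MvPolynomial.eval x (A i) = 0)
      have hνx : (fun i => ν i = true) = fun i => MvPolynomial.eval x (A i) = 0 := by
        funext i
        simp [ν]
      have hg0 : gx ν x ≠ 0 := by
        refine prod_ne_zero_iff.2 fun i hi => ?_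
        have h1 := (mem_filter.1 hi).2
        simpa [ν] using h1
      refine ⟨⟨Sum.elim x fun l => if l = ν then (gx ν x)⁻¹ else 0, ?_⟩, rfl⟩
      rw [hmem]
      refine ⟨ν, by rw [hνx]; exact hx, fun i hi => by simpa [ν] using hi, ?_, fun l hl => ?_⟩
      · show gx ν x * (if ν = ν then (gx ν x)⁻¹ else 0) = 1
        rw [if_pos rfl]
        exact mul_inv_cancel₀ hg0
      · show (if l = ν then (gx ν x)⁻¹ else 0) = 0
        rw [if_neg hl]
  -- transport to the numbering `Fin N` of the variables and `Fin r` of the equations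
  have hcardN : Nat.card {z : Fin N → K // ∀ l, MvPolynomial.eval z (f l) = 0}
      = Nat.card {w : Fin m ⊕ (Fin s → Bool) → K // ∀ G, MvPolynomial.eval w (F G) = 0} := by
    refine Nat.card_congr ((Equiv.arrowCongr eσ.symm (Equiv.refl K)).subtypeEquiv fun z => ?_)
    have hz : ∀ P : MvPolynomial (Fin m ⊕ (Fin s → Bool)) K,
        MvPolynomial.eval z (MvPolynomial.rename eσ P)
          = MvPolynomial.eval ((Equiv.arrowCongr eσ.symm (Equiv.refl K)) z) P := by
      intro P
      rw [MvPolynomial.eval_rename]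
      rfl
    simp only [f, hz]
    exact ⟨fun h1 G => by simpa using h1 (eG G), fun h1 l => h1 _⟩
  /- apply (3.3) and read off the estimate -/
  have hV := h K f hfdeg
  rw [hcardN, hcardV, ← hcount] at hV
  have hn₀le : definableCard K ψ c ≤ Fintype.card K ^ m := definableCard_le_card_pow K ψ c
  have hq1 : (1 : ℝ) ≤ (Fintype.card K : ℝ) := by exact_mod_cast Fintype.card_pos
  have hq0 : (0 : ℝ) < (Fintype.card K : ℝ) := by linarith
  by_cases hn : definableCard K ψ c = 0
  · exact Or.inl hn
  right
  by_cases hsmall : Fintype.card K < Q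
  · -- small fields: the pair `(0, |φ(K^m; c)|)`
    refine ⟨0, definableCard K ψ c, ⟨Nat.zero_le _, Nat.pos_of_ne_zero hn, ?_⟩, ?_⟩
    · calc definableCard K ψ c ≤ Fintype.card K ^ m := hn₀le
        _ ≤ Q ^ m := Nat.pow_le_pow_left hsmall.le m
        _ ≤ max M (Q ^ m) := le_max_right _ _
    · rw [pow_zero, mul_one, sub_self, abs_zero]
      positivity
  · push Not at hsmall
    rcases hV with h0 | ⟨d, μ, ⟨-, hμ1, hμM⟩, hest⟩
    · exact absurd h0 hn
    have hest' : |(definableCard K ψ c : ℝ) - μ * (Fintype.card K : ℝ) ^ d|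
        ≤ max C 0 * (Fintype.card K : ℝ) ^ ((d : ℝ) - 1 / 2) :=
      hest.trans (mul_le_mul_of_nonneg_right (le_max_left _ _) (Real.rpow_nonneg hq0.le _))
    by_cases hdm : d ≤ m
    · exact ⟨d, μ, ⟨hdm, hμ1, hμM.trans (le_max_left _ _)⟩, hest'⟩
    · -- `d > m` is impossible once `q ≥ (|C| + 1)²`
      exfalso
      push Not at hdm
      set q : ℝ := (Fintype.card K : ℝ) with hq
      have hQq : (Q : ℝ) ≤ q := by rw [hq]; exact_mod_cast hsmall
      have hQ' : (|C| + 1) ^ 2 + 2 ≤ (Q : ℝ) := by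
        rw [hQ]
        push_cast
        linarith [Nat.le_ceil ((|C| + 1) ^ 2)]
      set sq : ℝ := q ^ (1 / 2 : ℝ) with hsq
      have hsq_ge : |C| + 1 ≤ sq := by
        rw [hsq, ← Real.sqrt_eq_rpow]
        exact (Real.le_sqrt (by positivity) hq0.le).2 (by linarith)
      have hP0 : 0 < q ^ ((d : ℝ) - 1 / 2) := Real.rpow_pos_of_pos hq0 _
      have hPd : q ^ ((d : ℝ) - 1 / 2) * sq = q ^ d := by
        rw [hsq, ← Real.rpow_add hq0, sub_add_cancel, Real.rpow_natCast]
      obtain ⟨-, hlow⟩ := abs_sub_le_iff.1 hest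
      rw [← hPd] at hlow
      have hμ1' : (1 : ℝ) ≤ μ := by exact_mod_cast hμ1
      have hCP : C * q ^ ((d : ℝ) - 1 / 2) ≤ |C| * q ^ ((d : ℝ) - 1 / 2) :=
        mul_le_mul_of_nonneg_right (le_abs_self C) hP0.le
      have h2 : q ^ ((d : ℝ) - 1 / 2) * sq ≤ μ * (q ^ ((d : ℝ) - 1 / 2) * sq) :=
        le_mul_of_one_le_left (by positivity) hμ1'
      have h5 : q ^ ((d : ℝ) - 1 / 2) * (|C| + 1) ≤ q ^ ((d : ℝ) - 1 / 2) * sq :=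
        mul_le_mul_of_nonneg_left hsq_ge hP0.le
      have h1 : q ^ ((d : ℝ) - 1 / 2) ≤ definableCard K ψ c := by
        linarith only [hlow, hCP, h2, h5]
      have h3 : (definableCard K ψ c : ℝ) ≤ q ^ m := by rw [hq]; exact_mod_cast hn₀le
      have h4 : q ^ m < q ^ ((d : ℝ) - 1 / 2) := by
        have hq1' : 1 < q := by linarith only [hQq, hQ', sq_nonneg (|C| + 1)]
        have hmd : (m : ℝ) + 1 ≤ d := by exact_mod_cast hdm
        calc (q ^ m : ℝ) = q ^ (m : ℝ) := (Real.rpow_natCast q m).symm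
          _ < q ^ ((d : ℝ) - 1 / 2) :=
            Real.rpow_lt_rpow_of_exponent_lt hq1' (by linarith only [hmd])
      linarith only [h1, h3, h4]


/-- **The Main Theorem from Proposition (3.3) and the normal form (3)–(4).** Combining
`lemma35_of_prop33` with `mainTheorem_of_qf_of_decomposition`: the CDM Main Theorem follows from
(i) the dimension-free Lang–Weil estimate for arbitrary `k`-algebraic sets (CDM Prop. (3.3),
there from Lang–Weil [10] and the bounds (1.7)) and (ii) the normal form of p. 123 produced by
the positive quantifier elimination (2.7). These are now the only two inputs of the printed
proof that are not formalized. [cite: ChatzidakisVanDenDriesMacintyre1992, §3] -/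
theorem mainTheorem_of_prop33_of_decomposition
    (h33 : ∀ (N r e : ℕ), ∃ (C : ℝ) (M : ℕ), ∀ (K : Type) [Field K] [Fintype K]
      (f : Fin r → MvPolynomial (Fin N) K), (∀ l, (f l).totalDegree ≤ e) →
        Nat.card {z : Fin N → K // ∀ l, MvPolynomial.eval z (f l) = 0} = 0 ∨
        ∃ d μ : ℕ, (d ≤ N ∧ 1 ≤ μ ∧ μ ≤ M) ∧
          |(Nat.card {z : Fin N → K // ∀ l, MvPolynomial.eval z (f l) = 0} : ℝ)
              - μ * (Fintype.card K : ℝ) ^ d|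
            ≤ C * (Fintype.card K : ℝ) ^ ((d : ℝ) - 1 / 2))
    (hdec : ∀ (m n : ℕ) (φ : Language.ring.Formula (Fin m ⊕ Fin n)),
      ∃ (q₀ n' s : ℕ) (k e : Fin s → ℕ)
        (Ψ : ∀ i : Fin s, Language.ring.Formula ((Fin m ⊕ Fin (k i)) ⊕ Fin n')),
        (∀ i, (Ψ i).IsQF) ∧
        (∀ i (K : Type) [Field K] [Fintype K] (c' : Fin n' → K) (y : Fin m → K),
          (letI := compatibleRingOfRing K;
            Nat.card {z : Fin (k i) → K // (Ψ i).Realize (Sum.elim (Sum.elim y z) c')}) ≤ e i) ∧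
        ∀ (K : Type) [Field K] [Fintype K], q₀ ≤ Fintype.card K → ∀ (c : Fin n → K),
          ∃ c' : Fin n' → K, ∀ y : Fin m → K,
            (letI := compatibleRingOfRing K;
              (φ.Realize (Sum.elim y c) ↔
                  ∃ i, ∃ z : Fin (k i) → K, (Ψ i).Realize (Sum.elim (Sum.elim y z) c')) ∧
                ∀ i i', i ≠ i' → (∃ z : Fin (k i) → K, (Ψ i).Realize (Sum.elim (Sum.elim y z) c')) →
                  ¬∃ z : Fin (k i') → K, (Ψ i').Realize (Sum.elim (Sum.elim y z) c'))) :
    ChatzidakisVanDenDriesMacintyre1992_mainTheorem :=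
  mainTheorem_of_qf_of_decomposition (fun m n ψ hψ => lemma35_of_prop33 h33 m n ψ hψ) hdec

end Lemma35

/-! ## The normal form (3)–(4) from the positive quantifier elimination (2.7) (CDM 1992, p. 123) -/

section NormalForm

open FirstOrder FirstOrder.Language FirstOrder.Ring BoundedFormula Finset

/-! ### Ring terms with a distinguished variable are polynomials in it -/

/-- Realization of an iterated sum of ring terms. [folklore] -/
theorem realize_foldr_add {β : Type*} {K : Type*} [CommRing K]
    (l : List (Language.ring.Term β)) (v : β → K) :
    (letI := compatibleRingOfRing K; (l.foldr (· + ·) 0).realize v)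
      = (letI := compatibleRingOfRing K; (l.map (Term.realize v)).sum) := by
  letI := compatibleRingOfRing K
  induction l with
  | nil => simp
  | cons t l ih => simp [ih]

/-- Realization of an iterated product of ring terms. [folklore] -/
theorem realize_foldr_mul {β : Type*} {K : Type*} [CommRing K]
    (l : List (Language.ring.Term β)) (v : β → K) :
    (letI := compatibleRingOfRing K; (l.foldr (· * ·) 1).realize v)
      = (letI := compatibleRingOfRing K; (l.map (Term.realize v)).prod) := by
  letI := compatibleRingOfRing K
  induction l with
  | nil => simp
  | cons t l ih => simp [ih]

/-- A ring term `g(v, T)` with a distinguished variable `T` is a sum of monomials `co_i(v) T^{e_i}`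
whose coefficients are ring terms in the other variables. [folklore] -/
theorem exists_monomials_of_term {β : Type*} (g : Language.ring.Term (β ⊕ Fin 1)) :
    ∃ (ι : Type) (_ : Fintype ι) (co : ι → Language.ring.Term β) (ex : ι → ℕ),
      ∀ (K : Type) [CommRing K] (v : β → K) (t : K),
        (letI := compatibleRingOfRing K;
          g.realize (Sum.elim v fun _ => t) = ∑ i, (co i).realize v * t ^ ex i) := by
  induction g with
  | var a =>
    rcases a with b | o
    · refine ⟨Unit, inferInstance, fun _ => var b, fun _ => 0, fun K _ v t => ?_⟩
      letI := compatibleRingOfRing K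
      simp [Term.realize]
    · refine ⟨Unit, inferInstance, fun _ => 1, fun _ => 1, fun K _ v t => ?_⟩
      letI := compatibleRingOfRing K
      simp [Term.realize]
  | func f ts ih =>
    choose ι hι co ex hco using ih
    cases f with
    | add =>
      letI := hι 0; letI := hι 1
      refine ⟨ι 0 ⊕ ι 1, inferInstance, Sum.elim (co 0) (co 1), Sum.elim (ex 0) (ex 1),
        fun K _ v t => ?_⟩
      letI := compatibleRingOfRing K
      simp only [Term.realize, CompatibleRing.funMap_add, Fintype.sum_sum_type, Sum.elim_inl,
        Sum.elim_inr]
      have h0 := hco 0 K v t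
      have h1 := hco 1 K v t
      rw [h0, h1]
    | mul =>
      letI := hι 0; letI := hι 1
      refine ⟨ι 0 × ι 1, inferInstance, fun p => co 0 p.1 * co 1 p.2,
        fun p => ex 0 p.1 + ex 1 p.2, fun K _ v t => ?_⟩
      letI := compatibleRingOfRing K
      simp only [Term.realize, CompatibleRing.funMap_mul, Fintype.sum_prod_type]
      have h0 := hco 0 K v t
      have h1 := hco 1 K v t
      rw [h0, h1, sum_mul_sum]
      refine sum_congr rfl fun i _ => sum_congr rfl fun j _ => ?_
      have hm : Term.realize v (co 0 i * co 1 j) = Term.realize v (co 0 i) * Term.realize v (co 1 j) :=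
        realize_mul _ _ _
      rw [hm, pow_add]
      ring
    | neg =>
      letI := hι 0
      refine ⟨ι 0, inferInstance, fun i => -(co 0 i), ex 0, fun K _ v t => ?_⟩
      letI := compatibleRingOfRing K
      simp only [Term.realize, CompatibleRing.funMap_neg]
      have h0 := hco 0 K v t
      rw [h0, ← sum_neg_distrib]
      refine sum_congr rfl fun i _ => ?_
      have hn : Term.realize v (-(co 0 i)) = -Term.realize v (co 0 i) := realize_neg _ _
      rw [hn, neg_mul]
    | zero =>
      refine ⟨Empty, inferInstance, Empty.elim, Empty.elim, fun K _ v t => ?_⟩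
      letI := compatibleRingOfRing K
      simp [Term.realize]
    | one =>
      refine ⟨Unit, inferInstance, fun _ => 1, fun _ => 0, fun K _ v t => ?_⟩
      letI := compatibleRingOfRing K
      simp [Term.realize]

/-- **A ring term as a polynomial in a distinguished variable**, with coefficient TERMS: for a
ring term `g(v, T)` there are `D` and ring terms `Co_0(v), …, Co_D(v)` in the other variables
such that, in every field, (1) `g(v, t) = ∑_k Co_k(v) t^k`; (2) if some `Co_k(v) ≠ 0` then
`g(v, T)` has at most `D` roots `t`; (3) the "Rabinowitsch" equation `∏_k (Co_k(v)·u − 1) = 0`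
has at most `D + 1` solutions `u`, and has one iff some `Co_k(v) ≠ 0`; (4) if all
`Co_k(v) = 0` then `g(v, t) = 0` for all `t`. This is the bookkeeping behind
"write `g(X,Y,T) = ∑ g_i(X,Y) T^i`" and formula (2) of the proof of (3.7).
[cite: ChatzidakisVanDenDriesMacintyre1992, proof of (3.7), p. 123] -/
theorem exists_coeffTerms_of_term {β : Type*} (g : Language.ring.Term (β ⊕ Fin 1)) :
    ∃ (D : ℕ) (Co : Fin (D + 1) → Language.ring.Term β),
      ∀ (K : Type) [Field K] [Fintype K] (v : β → K),
        (letI := compatibleRingOfRing K;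
          (∀ t : K, g.realize (Sum.elim v fun _ => t) = ∑ k, (Co k).realize v * t ^ (k : ℕ)) ∧
          ((∃ k, (Co k).realize v ≠ 0) →
            Nat.card {t : K // g.realize (Sum.elim v fun _ => t) = 0} ≤ D) ∧
          (Nat.card {u : K // ∏ k, ((Co k).realize v * u - 1) = 0} ≤ D + 1) ∧
          ((∃ u : K, ∏ k, ((Co k).realize v * u - 1) = 0) ↔ ∃ k, (Co k).realize v ≠ 0)) := by
  classical
  obtain ⟨ι, _, co, ex, hg⟩ := exists_monomials_of_term g
  set D : ℕ := univ.sup ex with hD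
  have hexD : ∀ i, ex i < D + 1 := fun i => Nat.lt_succ_of_le (le_sup (f := ex) (mem_univ i))
  -- grouped coefficient terms
  let Co : Fin (D + 1) → Language.ring.Term β := fun k =>
    ((univ.filter fun i => ex i = k).toList.map co).foldr (· + ·) 0
  refine ⟨D, Co, fun K _ _ v => ?_⟩
  letI := compatibleRingOfRing K
  -- the values `a k` of the coefficients
  have ha' : ∀ k : Fin (D + 1), Term.realize v (Co k)
      = ∑ i ∈ univ.filter (fun i => ex i = k), (co i).realize v := by
    intro k
    simp only [Co]
    rw [realize_foldr_add, List.map_map, sum_map_toList]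
    rfl
  -- (1) the expansion
  have h1 : ∀ t : K, g.realize (Sum.elim v fun _ => t)
      = ∑ k, Term.realize v (Co k) * t ^ (k : ℕ) := by
    intro t
    rw [hg K v t]
    simp only [ha', sum_mul]
    symm
    have h := sum_fiberwise_of_maps_to (s := (univ : Finset ι)) (t := (univ : Finset (Fin (D + 1))))
      (g := fun i => (⟨ex i, hexD i⟩ : Fin (D + 1)))
      (f := fun i => Term.realize v (co i) * t ^ ex i) (fun i _ => mem_univ _)
    rw [← h]
    refine sum_congr rfl fun k _ => sum_congr ?_ fun i hi => ?_
    · ext i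
      simp only [mem_filter, mem_univ, true_and, Fin.ext_iff]
    · have hik : ex i = (k : ℕ) := by
        have h2 := (mem_filter.1 hi).2
        exact (Fin.ext_iff.1 h2)
      rw [hik]
  -- the polynomial `P = ∑ a_k X^k` and the Rabinowitsch polynomial `R = ∏ (a_k X − 1)`
  set P : Polynomial K :=
    ∑ k : Fin (D + 1), Polynomial.C (Term.realize v (Co k)) * Polynomial.X ^ (k : ℕ) with hP
  have hPeval : ∀ t, P.eval t = ∑ k, Term.realize v (Co k) * t ^ (k : ℕ) := fun t => by
    simp only [hP, Polynomial.eval_finsetSum, Polynomial.eval_mul, Polynomial.eval_C,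
      Polynomial.eval_pow, Polynomial.eval_X]
  have hPdeg : P.natDegree ≤ D := by
    refine Polynomial.natDegree_sum_le_of_forall_le _ _ fun k _ => ?_
    exact (Polynomial.natDegree_C_mul_X_pow_le _ _).trans (Nat.lt_succ_iff.1 k.2)
  have hPne : (∃ k, Term.realize v (Co k) ≠ 0) → P ≠ 0 := by
    rintro ⟨k₀, hk₀⟩ hP0
    apply hk₀
    have hc : P.coeff k₀ = Term.realize v (Co k₀) := by
      simp only [hP, Polynomial.finsetSum_coeff, Polynomial.coeff_C_mul_X_pow]
      rw [sum_eq_single k₀]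
      · simp
      · intro k _ hk
        rw [if_neg]
        exact fun h => hk (Fin.ext h).symm
      · simp
    rw [← hc, hP0, Polynomial.coeff_zero]
  set R : Polynomial K :=
    ∏ k : Fin (D + 1), (Polynomial.C (Term.realize v (Co k)) * Polynomial.X - 1) with hR
  have hReval : ∀ u, R.eval u = ∏ k, (Term.realize v (Co k) * u - 1) := fun u => by
    simp only [hR, Polynomial.eval_prod, Polynomial.eval_sub, Polynomial.eval_mul,
      Polynomial.eval_C, Polynomial.eval_X, Polynomial.eval_one]
  have hRne : R ≠ 0 := by
    intro hR0
    have h0 : R.eval 0 = (-1) ^ (D + 1) := by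
      rw [hReval]
      simp
    rw [hR0, Polynomial.eval_zero] at h0
    exact (pow_ne_zero (D + 1) (neg_ne_zero.2 (one_ne_zero' K))) h0.symm
  have hRdeg : R.natDegree ≤ D + 1 := by
    refine (Polynomial.natDegree_prod_le _ _).trans ?_
    refine (sum_le_card_nsmul _ _ 1 fun k _ => ?_).trans (by simp)
    refine (Polynomial.natDegree_sub_le _ _).trans (max_le ?_ (by simp))
    simpa using Polynomial.natDegree_C_mul_X_pow_le (Term.realize v (Co k)) 1
  -- counting roots
  have hroots : ∀ (S : Polynomial K), S ≠ 0 →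
      Nat.card {t : K // S.eval t = 0} ≤ S.natDegree := by
    intro S hS
    rw [Nat.card_eq_fintype_card, Fintype.card_subtype]
    calc (univ.filter fun t => S.eval t = 0).card ≤ S.roots.toFinset.card := by
          refine card_le_card fun t ht => ?_
          rw [Multiset.mem_toFinset, Polynomial.mem_roots hS]
          exact (mem_filter.1 ht).2
      _ ≤ Multiset.card S.roots := Multiset.toFinset_card_le _
      _ ≤ S.natDegree := Polynomial.card_roots' _
  refine ⟨h1, fun hk => ?_, ?_, ?_⟩
  · -- (2)
    have h := hroots P (hPne hk)
    calc Nat.card {t : K // g.realize (Sum.elim v fun _ => t) = 0}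
        = Nat.card {t : K // P.eval t = 0} := by
          refine Nat.card_congr (Equiv.subtypeEquivRight fun t => ?_)
          rw [h1, hPeval]
      _ ≤ P.natDegree := h
      _ ≤ D := hPdeg
  · -- (3)
    calc Nat.card {u : K // ∏ k, (Term.realize v (Co k) * u - 1) = 0}
        = Nat.card {u : K // R.eval u = 0} := by
          refine Nat.card_congr (Equiv.subtypeEquivRight fun u => ?_)
          rw [hReval]
      _ ≤ R.natDegree := hroots R hRne
      _ ≤ D + 1 := hRdeg
  · -- the Rabinowitsch equation is solvable iff some coefficient is nonzero
    constructor
    · rintro ⟨u, hu⟩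
      by_contra hall
      push Not at hall
      have : (∏ k : Fin (D + 1), (Term.realize v (Co k) * u - 1)) = (-1) ^ (D + 1) := by
        simp [hall]
      rw [this] at hu
      exact (pow_ne_zero (D + 1) (neg_ne_zero.2 (one_ne_zero' K))) hu
    · rintro ⟨k, hk⟩
      refine ⟨(Term.realize v (Co k))⁻¹, prod_eq_zero (mem_univ k) ?_⟩
      rw [mul_inv_cancel₀ hk, sub_self]


/-! ### The normal form (3)–(4) from the positive quantifier elimination (2.7) -/

/-- **The normal form of p. 123 from Proposition (2.7).** ASSUME (2.7) in the form in which the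
proof of (3.7) uses it: for every ring formula `φ(y; c)` there are `q₀`, `n'` and finitely many
ring terms `g_l(y, c', T)` such that in every finite field with `q ≥ q₀`, for all parameters `c`
there are parameters `c'` (namely `c` together with the coefficients `c_{ni}` of irreducible
monic polynomials of each degree `n ≤ n₀`, an enrichment of the field — the constants of `L(c)`
"replaced by extra parametric variables `X'`") with `φ(y; c) ↔ ⋀_l ∃ T g_l(y, c', T) = 0` for all
`y`. THEN the normal form (3)–(4): `φ(K^m; c)` is, for `q ≥ q₀`, the disjoint union over the
subsets `S` of the index set of the projections of the quantifier-free families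
`Ψ_S(y, z; c') := ⋀_{l ∈ S} ⋀_i g_{l,i}(y,c') = 0 ∧ ⋀_{l ∉ S} (g_l(y,c',t_l) = 0 ∧ ∏_i (g_{l,i}(y,c') u_l − 1) = 0)`,
`z = (t_l, u_l)_{l ∉ S}`, each with at most `e_S = ∏_{l ∉ S} D_l (D_l + 1)` witnesses `z`
(formula (2): `∃T g = 0 ⇔ (⋀_i g_i = 0) ∨ (∃T g = 0 ∧ ∃U ∏_i (g_i U − 1) = 0)`, the two
disjuncts being disjoint, then the distributive law; `g = ∑_i g_i T^i` by
`exists_coeffTerms_of_term`).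
[cite: ChatzidakisVanDenDriesMacintyre1992, (2.7) and proof of (3.7), pp. 118, 123] -/
theorem decomposition_of_positiveQE
    (h27 : ∀ (m n : ℕ) (φ : Language.ring.Formula (Fin m ⊕ Fin n)),
      ∃ (q₀ n' L : ℕ) (g : Fin L → Language.ring.Term ((Fin m ⊕ Fin n') ⊕ Fin 1)),
        ∀ (K : Type) [Field K] [Fintype K], q₀ ≤ Fintype.card K → ∀ c : Fin n → K,
          ∃ c' : Fin n' → K, ∀ y : Fin m → K,
            (letI := compatibleRingOfRing K;
              (φ.Realize (Sum.elim y c) ↔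
                ∀ l, ∃ t : K, (g l).realize (Sum.elim (Sum.elim y c') fun _ => t) = 0)))
    (m n : ℕ) (φ : Language.ring.Formula (Fin m ⊕ Fin n)) :
    ∃ (q₀ n' s : ℕ) (k e : Fin s → ℕ)
      (Ψ : ∀ i : Fin s, Language.ring.Formula ((Fin m ⊕ Fin (k i)) ⊕ Fin n')),
      (∀ i, (Ψ i).IsQF) ∧
      (∀ i (K : Type) [Field K] [Fintype K] (c' : Fin n' → K) (y : Fin m → K),
        (letI := compatibleRingOfRing K;
          Nat.card {z : Fin (k i) → K // (Ψ i).Realize (Sum.elim (Sum.elim y z) c')}) ≤ e i) ∧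
      ∀ (K : Type) [Field K] [Fintype K], q₀ ≤ Fintype.card K → ∀ (c : Fin n → K),
        ∃ c' : Fin n' → K, ∀ y : Fin m → K,
          (letI := compatibleRingOfRing K;
            (φ.Realize (Sum.elim y c) ↔
                ∃ i, ∃ z : Fin (k i) → K, (Ψ i).Realize (Sum.elim (Sum.elim y z) c')) ∧
              ∀ i i', i ≠ i' → (∃ z : Fin (k i) → K, (Ψ i).Realize (Sum.elim (Sum.elim y z) c')) →
                ¬∃ z : Fin (k i') → K, (Ψ i').Realize (Sum.elim (Sum.elim y z) c')) := by
  classical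
  obtain ⟨q₀, n', L, g, hg⟩ := h27 m n φ
  have hco := fun l => exists_coeffTerms_of_term (g l)
  choose D Co hCo using hco
  /- the data -/
  -- the "free" indices of a disjunct `S` (those `l` with `∃T g_l = 0` kept), and its variables
  let FS : (Fin L → Bool) → Type := fun S => {l : Fin L // S l = false}
  let kS : (Fin L → Bool) → ℕ := fun S => Fintype.card (FS S ⊕ FS S)
  let eFS : ∀ S, (FS S ⊕ FS S) ≃ Fin (kS S) := fun S => Fintype.equivFin _
  let eB : (Fin L → Bool) → ℕ := fun S => ∏ l : FS S, (D l.1 * (D l.1 + 1))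
  -- variable renamings into `(Fin m ⊕ (FS S ⊕ FS S)) ⊕ Fin n'`
  let ρ₀ : ∀ S, (Fin m ⊕ Fin n') → ((Fin m ⊕ (FS S ⊕ FS S)) ⊕ Fin n') := fun S =>
    Sum.elim (fun i => Sum.inl (Sum.inl i)) fun j => Sum.inr j
  let ρt : ∀ S, FS S → ((Fin m ⊕ Fin n') ⊕ Fin 1) → ((Fin m ⊕ (FS S ⊕ FS S)) ⊕ Fin n') :=
    fun S l => Sum.elim (ρ₀ S) fun _ => Sum.inl (Sum.inr (Sum.inl l))
  let ρu : ∀ S, FS S → ((Fin m ⊕ Fin n') ⊕ Fin 1) → ((Fin m ⊕ (FS S ⊕ FS S)) ⊕ Fin n') :=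
    fun S l => Sum.elim (ρ₀ S) fun _ => Sum.inl (Sum.inr (Sum.inr l))
  -- the Rabinowitsch terms `∏_i (g_{l,i} U − 1)`
  let rab : ∀ l : Fin L, Language.ring.Term ((Fin m ⊕ Fin n') ⊕ Fin 1) := fun l =>
    ((univ : Finset (Fin (D l + 1))).toList.map fun k =>
      (Co l k).relabel Sum.inl * var (Sum.inr 0) + -1).foldr (· * ·) 1
  -- the formulas `Ψ_S`
  let Ψpre : ∀ S, Language.ring.Formula ((Fin m ⊕ (FS S ⊕ FS S)) ⊕ Fin n') := fun S =>
    (BoundedFormula.iInf fun l : {l : Fin L // S l = true} =>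
        BoundedFormula.iInf fun k : Fin (D l.1 + 1) =>
          Term.equal ((Co l.1 k).relabel (ρ₀ S)) 0) ⊓
      BoundedFormula.iInf fun l : FS S =>
        Term.equal ((g l.1).relabel (ρt S l)) 0 ⊓ Term.equal ((rab l.1).relabel (ρu S l)) 0
  let ΨS : ∀ S, Language.ring.Formula ((Fin m ⊕ Fin (kS S)) ⊕ Fin n') := fun S =>
    (Ψpre S).relabel (Sum.map (Sum.map id (eFS S)) id)
  let sN : ℕ := Fintype.card (Fin L → Bool)
  let eS : Fin sN ≃ (Fin L → Bool) := (Fintype.equivFin _).symm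
  /- semantics -/
  have hrab : ∀ (l : Fin L) (K : Type) [Field K] (v : Fin m ⊕ Fin n' → K) (u : K),
      (letI := compatibleRingOfRing K; (rab l).realize (Sum.elim v fun _ => u))
        = (letI := compatibleRingOfRing K; ∏ k, ((Co l k).realize v * u - 1)) := by
    intro l K _ v u
    letI := compatibleRingOfRing K
    simp only [rab]
    rw [realize_foldr_mul, List.map_map, prod_map_toList]
    refine prod_congr rfl fun k _ => ?_
    simp only [Function.comp, realize_add, realize_mul, realize_neg, realize_one,
      Term.realize_relabel, Term.realize, Sum.elim_inr, sub_eq_add_neg]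
    rfl
  have hpre : ∀ (S : Fin L → Bool) (K : Type) [Field K] (c' : Fin n' → K) (y : Fin m → K)
      (zz : FS S ⊕ FS S → K),
      (letI := compatibleRingOfRing K; (Ψpre S).Realize (Sum.elim (Sum.elim y zz) c')) ↔
        (letI := compatibleRingOfRing K;
          (∀ l : {l : Fin L // S l = true}, ∀ k, (Co l.1 k).realize (Sum.elim y c') = 0) ∧
          ∀ l : FS S, (g l.1).realize (Sum.elim (Sum.elim y c') fun _ => zz (Sum.inl l)) = 0 ∧
            ∏ k, ((Co l.1 k).realize (Sum.elim y c') * zz (Sum.inr l) - 1) = 0) := by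
    intro S K _ c' y zz
    letI := compatibleRingOfRing K
    have hρ₀ : Sum.elim (Sum.elim y zz) c' ∘ ρ₀ S = Sum.elim y c' := by
      funext b; rcases b with i | j <;> rfl
    have hρt : ∀ l, Sum.elim (Sum.elim y zz) c' ∘ ρt S l
        = Sum.elim (Sum.elim y c') fun _ => zz (Sum.inl l) := by
      intro l; funext b; rcases b with (i | j) | o <;> rfl
    have hρu : ∀ l, Sum.elim (Sum.elim y zz) c' ∘ ρu S l
        = Sum.elim (Sum.elim y c') fun _ => zz (Sum.inr l) := by
      intro l; funext b; rcases b with (i | j) | o <;> rfl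
    simp only [Ψpre, Formula.realize_inf]
    refine and_congr ?_ ?_
    · change (BoundedFormula.iInf _).Realize _ default ↔ _
      rw [realize_iInf]
      refine forall_congr' fun l => ?_
      rw [realize_iInf]
      refine forall_congr' fun k => ?_
      change (Term.equal _ _).Realize _ ↔ _
      rw [Formula.realize_equal, Term.realize_relabel, hρ₀]
      simp
    · change (BoundedFormula.iInf _).Realize _ default ↔ _
      rw [realize_iInf]
      refine forall_congr' fun l => ?_
      change (Term.equal _ _ ⊓ Term.equal _ _).Realize _ ↔ _
      rw [Formula.realize_inf, Formula.realize_equal, Formula.realize_equal, Term.realize_relabel,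
        Term.realize_relabel, hρt, hρu, hrab]
      simp
  have hΨS : ∀ (S : Fin L → Bool) (K : Type) [Field K] (c' : Fin n' → K) (y : Fin m → K)
      (z : Fin (kS S) → K),
      (letI := compatibleRingOfRing K; (ΨS S).Realize (Sum.elim (Sum.elim y z) c')) ↔
        (letI := compatibleRingOfRing K; (Ψpre S).Realize (Sum.elim (Sum.elim y (z ∘ eFS S)) c')) := by
    intro S K _ c' y z
    letI := compatibleRingOfRing K
    have h : Sum.elim (Sum.elim y z) c' ∘ Sum.map (Sum.map id (eFS S)) id
        = Sum.elim (Sum.elim y (z ∘ eFS S)) c' := by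
      funext b; rcases b with (i | w) | j <;> rfl
    simp only [ΨS]
    rw [Formula.realize_relabel, h]
  /- the three properties -/
  refine ⟨q₀, n', sN, fun i => kS (eS i), fun i => eB (eS i), fun i => ΨS (eS i), ?_, ?_, ?_⟩
  · -- quantifier-free
    intro i
    refine isQF_formulaRelabel (IsQF.inf (isQF_iInf fun l => isQF_iInf fun k => ?_)
      (isQF_iInf fun l => IsQF.inf ?_ ?_)) _
    all_goals exact (IsAtomic.equal _ _).isQF
  · -- property (4): at most `e_S` witnesses
    intro i K _ _ c' y
    letI := compatibleRingOfRing K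
    set S := eS i with hSdef
    set v : Fin m ⊕ Fin n' → K := Sum.elim y c' with hv
    -- the fibres of the two auxiliary variables of a free index
    let T : FS S → Type := fun l =>
      {t : K // (g l.1).realize (Sum.elim v fun _ => t) = 0}
    let U : FS S → Type := fun l =>
      {u : K // ∏ k, ((Co l.1 k).realize v * u - 1) = 0}
    have hTU : ∀ l : FS S, Nat.card (T l × U l) ≤ D l.1 * (D l.1 + 1) := by
      intro l
      rw [Nat.card_prod]
      by_cases hU : Nonempty (U l)
      · obtain ⟨⟨u, hu⟩⟩ := hU
        have hk : ∃ k, (Co l.1 k).realize v ≠ 0 := (hCo l.1 K v).2.2.2.1 ⟨u, hu⟩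
        exact Nat.mul_le_mul ((hCo l.1 K v).2.1 hk) (hCo l.1 K v).2.2.1
      · rw [not_nonempty_iff] at hU
        simp
    calc Nat.card {z : Fin (kS S) → K // (ΨS S).Realize (Sum.elim (Sum.elim y z) c')}
        = Nat.card {zz : FS S ⊕ FS S → K // (Ψpre S).Realize (Sum.elim (Sum.elim y zz) c')} := by
          refine Nat.card_congr ((Equiv.arrowCongr (eFS S).symm (Equiv.refl K)).subtypeEquiv
            fun z => ?_)
          rw [hΨS]
          rfl
      _ ≤ Nat.card (∀ l : FS S, T l × U l) := by
          refine Nat.card_le_card_of_injective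
            (fun zz l => (⟨zz.1 (Sum.inl l), ((hpre S K c' y zz.1).1 zz.2).2 l |>.1⟩,
              ⟨zz.1 (Sum.inr l), ((hpre S K c' y zz.1).1 zz.2).2 l |>.2⟩)) ?_
          rintro ⟨z₁, h₁⟩ ⟨z₂, h₂⟩ h
          apply Subtype.ext
          funext w
          rcases w with l | l
          · have := congrArg (fun F => (F l).1.1) h
            exact this
          · have := congrArg (fun F => (F l).2.1) h
            exact this
      _ = ∏ l : FS S, Nat.card (T l × U l) := Nat.card_pi
      _ ≤ ∏ l : FS S, (D l.1 * (D l.1 + 1)) :=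
          prod_le_prod (fun l _ => Nat.zero_le _) fun l _ => hTU l
  · -- the decomposition and its disjointness, for `q ≥ q₀`
    intro K _ _ hq c
    letI := compatibleRingOfRing K
    obtain ⟨c', hc'⟩ := hg K hq c
    refine ⟨c', fun y => ?_⟩
    set v : Fin m ⊕ Fin n' → K := Sum.elim y c' with hv
    -- unpacking `Ψ_S(y, z; c')`
    have hunpack : ∀ (S : Fin L → Bool) (z : Fin (kS S) → K),
        (ΨS S).Realize (Sum.elim (Sum.elim y z) c') →
          (∀ l, S l = true → ∀ k, (Co l k).realize v = 0) ∧
          (∀ l, S l = false → (∃ t, (g l).realize (Sum.elim v fun _ => t) = 0) ∧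
            ∃ k, (Co l k).realize v ≠ 0) := by
      intro S z hz
      rw [hΨS, hpre] at hz
      refine ⟨fun l hl k => hz.1 ⟨l, hl⟩ k, fun l hl => ⟨⟨_, (hz.2 ⟨l, hl⟩).1⟩, ?_⟩⟩
      exact (hCo l K v).2.2.2.1 ⟨_, (hz.2 ⟨l, hl⟩).2⟩
    constructor
    · rw [hc' y]
      constructor
      · -- `⋀_l ∃T g_l = 0` ⟹ the disjunct `S = {l : all g_{l,i} = 0}`
        intro H
        let S : Fin L → Bool := fun l => decide (∀ k, (Co l k).realize v = 0)
        refine ⟨eS.symm S, ?_⟩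
        have hS' : eS (eS.symm S) = S := eS.apply_symm_apply S
        dsimp only
        rw [hS']
        -- witnesses for the free indices
        have ht : ∀ l : FS S, ∃ t, (g l.1).realize (Sum.elim v fun _ => t) = 0 := fun l => H l.1
        have hu : ∀ l : FS S, ∃ u, ∏ k, ((Co l.1 k).realize v * u - 1) = 0 := by
          intro l
          rw [(hCo l.1 K v).2.2.2]
          have hl : S l.1 = false := l.2
          simpa [S] using hl
        choose t ht using ht
        choose u hu using hu
        refine ⟨Sum.elim t u ∘ (eFS S).symm, ?_⟩
        rw [hΨS, hpre]
        have hcomp : (Sum.elim t u ∘ (eFS S).symm) ∘ (eFS S) = Sum.elim t u := by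
          funext w; simp
        rw [hcomp]
        refine ⟨fun l k => ?_, fun l => ⟨ht l, hu l⟩⟩
        have hl : S l.1 = true := l.2
        have : ∀ k, (Co l.1 k).realize v = 0 := by simpa [S] using hl
        exact this k
      · -- a disjunct ⟹ `⋀_l ∃T g_l = 0`
        rintro ⟨i, z, hz⟩ l
        obtain ⟨hzero, hfree⟩ := hunpack (eS i) z hz
        cases hSl : (eS i) l with
        | false => exact (hfree l hSl).1
        | true =>
          refine ⟨0, ?_⟩
          rw [(hCo l K v).1]
          simp [hzero l hSl]
    · -- disjointness
      rintro i i' hii' ⟨z, hz⟩ ⟨z', hz'⟩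
      obtain ⟨hzero, hfree⟩ := hunpack (eS i) z hz
      obtain ⟨hzero', hfree'⟩ := hunpack (eS i') z' hz'
      have hne : eS i ≠ eS i' := fun h => hii' (eS.injective h)
      obtain ⟨l, hl⟩ := Function.ne_iff.1 hne
      cases h1 : (eS i) l with
      | true =>
        have h2 : (eS i') l = false := by
          cases h3 : (eS i') l with
          | false => rfl
          | true => exact absurd (h1.trans h3.symm) hl
        obtain ⟨k, hk⟩ := (hfree' l h2).2
        exact hk (hzero l h1 k)
      | false =>
        have h2 : (eS i') l = true := by
          cases h3 : (eS i') l with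
          | true => rfl
          | false => exact absurd (h1.trans h3.symm) hl
        obtain ⟨k, hk⟩ := (hfree l h1).2
        exact hk (hzero' l h2 k)

/-- **The CDM Main Theorem from its two printed inputs, (3.3) and (2.7).** Combining
`decomposition_of_positiveQE` with `mainTheorem_of_prop33_of_decomposition`: the Main Theorem
`ChatzidakisVanDenDriesMacintyre1992_mainTheorem` follows from
(i) Prop. (3.3) — the Lang–Weil estimate for arbitrary `k`-algebraic sets, here in the
dimension-free form with integer measures (in the paper from Lang–Weil [10] and the bounds (1.7)
of §1); and (ii) Prop. (2.7) — the positive quantifier elimination, in the form "for `q ≥ q₀`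
and all `c` there are `c'` with `φ(y;c) ↔ ⋀_l ∃T g_l(y,c',T) = 0`" (in the paper from van den
Dries' (2.4) for perfect PAC fields, the coding (2.2), Weil's theorem and compactness; the
existence of enrichments of every finite field is part of this hypothesis). Everything else in
the printed proof of (3.7) is formalized in this file.
[cite: ChatzidakisVanDenDriesMacintyre1992, §§2–3] -/
theorem mainTheorem_of_prop33_of_positiveQE
    (h33 : ∀ (N r e : ℕ), ∃ (C : ℝ) (M : ℕ), ∀ (K : Type) [Field K] [Fintype K]
      (f : Fin r → MvPolynomial (Fin N) K), (∀ l, (f l).totalDegree ≤ e) →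
        Nat.card {z : Fin N → K // ∀ l, MvPolynomial.eval z (f l) = 0} = 0 ∨
        ∃ d μ : ℕ, (d ≤ N ∧ 1 ≤ μ ∧ μ ≤ M) ∧
          |(Nat.card {z : Fin N → K // ∀ l, MvPolynomial.eval z (f l) = 0} : ℝ)
              - μ * (Fintype.card K : ℝ) ^ d|
            ≤ C * (Fintype.card K : ℝ) ^ ((d : ℝ) - 1 / 2))
    (h27 : ∀ (m n : ℕ) (φ : Language.ring.Formula (Fin m ⊕ Fin n)),
      ∃ (q₀ n' L : ℕ) (g : Fin L → Language.ring.Term ((Fin m ⊕ Fin n') ⊕ Fin 1)),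
        ∀ (K : Type) [Field K] [Fintype K], q₀ ≤ Fintype.card K → ∀ c : Fin n → K,
          ∃ c' : Fin n' → K, ∀ y : Fin m → K,
            (letI := compatibleRingOfRing K;
              (φ.Realize (Sum.elim y c) ↔
                ∀ l, ∃ t : K, (g l).realize (Sum.elim (Sum.elim y c') fun _ => t) = 0))) :
    ChatzidakisVanDenDriesMacintyre1992_mainTheorem :=
  mainTheorem_of_prop33_of_decomposition h33 fun m n φ => decomposition_of_positiveQE h27 m n φ

end NormalForm

/-! ### The two external inputs in their printed form (CDM Prop. 3.3 and Prop. 2.7)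

The theorem `mainTheorem_of_prop33_of_positiveQE` above proves the Main Theorem from the two
published results it rests on, taken as hypotheses in the shape in which §3 consumes them. This
section restates those hypotheses VERBATIM as printed and proves the Main Theorem from the printed
forms, so that named facts vendoring CDM (3.3) and the finite-field clause of CDM (2.7) plug in
without further glue:

* (3.3), p. 121: "Let `f` be of degree `≤ e`. Then there is a positive constant `C` and a natural
  number `M`, both depending only on `(e, n, r)`, such that if `V(k) ≠ ∅`, then
  `|card(V(k)) − μ q^d| ≤ C q^{d − (1/2)}`, for some `d ∈ {0, …, dim(V)}` and some
  `μ ∈ {1, …, M}`" — with `d ≤ n` for `d ≤ dim V` (the tree has no dimension theory for affine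
  algebraic sets; `dim V ≤ n`).
* (2.6)–(2.7), pp. 117–118: enriched finite fields interpret, for each `n > 1`, constants
  `c_{n1}, …, c_{nn}` "as the coefficients of an irreducible monic polynomial
  `Tⁿ + c_{n1}T^{n−1} + … + c_{nn}`", and "Each `L(c)`-formula `φ(X)` is equivalent, uniformly for
  all enriched pseudo-finite fields, to a conjunction of formulas `∃T (g(c, X, T) = 0)`, with
  `g(C, X, T) ∈ ℤ[C, X, T]` […]. Such an equivalence also holds for all sufficiently large enriched
  finite fields." We use the finite-field clause, for ring formulas `φ` in `X = (X₁, …, X_m)`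
  (an `L(c)`-formula is an `L`-formula with some variables evaluated at the constants, so nothing
  is lost), the constants mentioned being those of degree `k + 2`, `k < B`, indexed by
  `Σ k : Fin B, Fin (k + 2)` (`c ⟨k, i⟩` = the coefficient of `T^i`), for EVERY such enrichment of
  every finite field with `≥ q₀` elements; the `g_l` are ring terms in `(C, X, T)` (= integer
  polynomials up to realization).
-/

section PrintedInputs

open Polynomial in
/-- Over a finite field there is a monic irreducible polynomial of every positive degree (the
minimal polynomial of a primitive element of Mathlib's `FiniteField.Extension K p m`); hence
"each finite field can be so enriched" (CDM (2.6)). [folklore] -/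
theorem exists_monic_irreducible_natDegree_eq (K : Type*) [Field K] [Finite K] {m : ℕ}
    (hm : 0 < m) : ∃ μ : K[X], μ.Monic ∧ Irreducible μ ∧ μ.natDegree = m := by
  haveI : Fact (ringChar K).Prime := ⟨CharP.char_is_prime K (ringChar K)⟩
  haveI : NeZero m := ⟨hm.ne'⟩
  let E := FiniteField.Extension K (ringChar K) m
  obtain ⟨α, hα⟩ := Field.exists_primitive_element K E
  have hint : IsIntegral K α := .of_finite K α
  refine ⟨minpoly K α, minpoly.monic hint, minpoly.irreducible hint, ?_⟩
  rw [← IntermediateField.adjoin.finrank hint, hα, IntermediateField.finrank_top',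
    FiniteField.finrank_extension]

open Polynomial in
/-- Every finite field admits an enrichment of every depth `B`: constants `c ⟨k, i⟩`
(`k < B`, `i < k + 2`) such that each `T^{k+2} + Σ_{i<k+2} c_{k,i} T^i` is irreducible.
[cite: ChatzidakisVanDenDriesMacintyre1992, (2.6)] -/
theorem exists_enrichment (K : Type*) [Field K] [Finite K] (B : ℕ) :
    ∃ c : (Σ k : Fin B, Fin (k.1 + 2)) → K,
      ∀ k : Fin B, Irreducible (X ^ (k.1 + 2) + ∑ i : Fin (k.1 + 2), C (c ⟨k, i⟩) * X ^ (i : ℕ)) := by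
  have h := fun k : Fin B =>
    exists_monic_irreducible_natDegree_eq K (m := k.1 + 2) (Nat.succ_pos _)
  choose μ hmonic hirr hdeg using h
  refine ⟨fun ki => (μ ki.1).coeff ki.2, fun k => ?_⟩
  have : X ^ (k.1 + 2) + ∑ i : Fin (k.1 + 2), C ((μ k).coeff i) * X ^ (i : ℕ) = μ k := by
    conv_rhs => rw [(hmonic k).as_sum, hdeg k]
    congr 1
    exact Fin.sum_univ_eq_sum_range (fun i => C ((μ k).coeff i) * X ^ i) (k.1 + 2)
  rw [this]
  exact hirr k

/-- **The finite-field clause of CDM Prop. (2.7) implies the normal-form hypothesis `h27` of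
`decomposition_of_positiveQE` / `mainTheorem_of_prop33_of_positiveQE`**: for a ring formula
`φ(y; c)` with parameters, relabel `(y, c)` into one tuple `X`, apply (2.7), and take for the extra
constants `c'` the parameters `c` together with an enrichment of the field (which exists by
`exists_enrichment`). [cite: ChatzidakisVanDenDriesMacintyre1992, Prop. 2.7 and p. 123] -/
theorem positiveQE_of_prop27
    (h27 : ∀ (m : ℕ) (φ : Language.ring.Formula (Fin m)),
      ∃ (B q₀ L : ℕ)
        (g : Fin L → Language.ring.Term (((Σ k : Fin B, Fin (k.1 + 2)) ⊕ Fin m) ⊕ Fin 1)),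
        ∀ (K : Type) [Field K] [Fintype K], q₀ ≤ Fintype.card K →
          ∀ c : (Σ k : Fin B, Fin (k.1 + 2)) → K,
            (∀ k : Fin B, Irreducible (Polynomial.X ^ (k.1 + 2) +
              ∑ i : Fin (k.1 + 2), Polynomial.C (c ⟨k, i⟩) * Polynomial.X ^ (i : ℕ))) →
            ∀ x : Fin m → K,
              (letI := compatibleRingOfRing K;
                (φ.Realize x ↔
                  ∀ l, ∃ t : K, (g l).realize (Sum.elim (Sum.elim c x) fun _ => t) = 0)))
    (m n : ℕ) (φ : Language.ring.Formula (Fin m ⊕ Fin n)) :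
    ∃ (q₀ n' L : ℕ) (g : Fin L → Language.ring.Term ((Fin m ⊕ Fin n') ⊕ Fin 1)),
      ∀ (K : Type) [Field K] [Fintype K], q₀ ≤ Fintype.card K → ∀ c : Fin n → K,
        ∃ c' : Fin n' → K, ∀ y : Fin m → K,
          (letI := compatibleRingOfRing K;
            (φ.Realize (Sum.elim y c) ↔
              ∀ l, ∃ t : K, (g l).realize (Sum.elim (Sum.elim y c') fun _ => t) = 0)) := by
  classical
  -- merge the set variables and the parameters into one tuple `X = (X₁, …, X_{m+n})`
  obtain ⟨B, q₀, L, g, hg⟩ := h27 (m + n) (φ.relabel finSumFinEquiv)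
  -- the new constants `c'`: an enrichment of depth `B` followed by the parameters `c`, listed
  -- through `eI`; the variables `((C, X), T)` of the `g_l` are renamed accordingly by `ρ`
  let eI : (Σ k : Fin B, Fin (k.1 + 2)) ⊕ Fin n ≃ Fin (Fintype.card (Σ k : Fin B, Fin (k.1 + 2)) + n) :=
    (Equiv.sumCongr (Fintype.equivFin _) (Equiv.refl (Fin n))).trans finSumFinEquiv
  let ρ : ((Σ k : Fin B, Fin (k.1 + 2)) ⊕ Fin (m + n)) ⊕ Fin 1 →
      (Fin m ⊕ Fin (Fintype.card (Σ k : Fin B, Fin (k.1 + 2)) + n)) ⊕ Fin 1 :=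
    Sum.map (Sum.elim (fun i => Sum.inr (eI (Sum.inl i)))
      (fun j => Sum.elim (fun a => Sum.inl a) (fun b => Sum.inr (eI (Sum.inr b)))
        (finSumFinEquiv.symm j))) id
  refine ⟨q₀, Fintype.card (Σ k : Fin B, Fin (k.1 + 2)) + n, L, fun l => (g l).relabel ρ,
    fun K _ _ hq c => ?_⟩
  letI := compatibleRingOfRing K
  obtain ⟨cK, hcK⟩ := exists_enrichment K B
  refine ⟨fun j => Sum.elim cK c (eI.symm j), fun y => ?_⟩
  have hφ : φ.Realize (Sum.elim y c) ↔
      (φ.relabel finSumFinEquiv).Realize (Sum.elim y c ∘ finSumFinEquiv.symm) := by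
    rw [Formula.realize_relabel]
    constructor <;> intro h <;> convert h using 2 <;> ext s <;> simp
  have hv : ∀ t : K,
      (Sum.elim (Sum.elim y fun j => Sum.elim cK c (eI.symm j)) fun _ : Fin 1 => t) ∘ ρ =
        Sum.elim (Sum.elim cK (Sum.elim y c ∘ finSumFinEquiv.symm)) fun _ => t := by
    intro t
    funext s
    rcases s with (i | j) | u
    · simp [ρ]
    · simp only [ρ, Function.comp_apply, Sum.map_inl, Sum.elim_inr, Sum.elim_inl]
      rcases finSumFinEquiv.symm j with a | b
      · simp
      · simp
    · simp [ρ]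
  rw [hφ, hg K hq cK hcK (Sum.elim y c ∘ finSumFinEquiv.symm)]
  refine forall_congr' fun l => exists_congr fun t => ?_
  rw [Term.realize_relabel, hv t]

/-- **The CDM Main Theorem from its two printed external inputs.** `h33` is CDM Proposition (3.3)
as printed (with `d ≤ n` for `d ≤ dim V`), `h27` the finite-field clause of CDM Proposition (2.7)
as printed (module docstring of this section); everything else — Lemma (3.5), the normal form
(3)–(4) of p. 123 and the counting (5)–(9) of pp. 123–125 — is proved above.
[cite: ChatzidakisVanDenDriesMacintyre1992, Prop. 3.3, Prop. 2.7, Thm. 3.7] -/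
theorem mainTheorem_of_prop33_of_prop27
    (h33 : ∀ (e n r : ℕ), ∃ (C : ℝ) (M : ℕ), 0 < C ∧
      ∀ (K : Type) [Field K] [Fintype K] (f : Fin r → MvPolynomial (Fin n) K),
        (∀ i, (f i).totalDegree ≤ e) →
          Nat.card {y : Fin n → K // ∀ i, MvPolynomial.eval y (f i) = 0} = 0 ∨
            ∃ d μ : ℕ, (d ≤ n ∧ 1 ≤ μ ∧ μ ≤ M) ∧
              |(Nat.card {y : Fin n → K // ∀ i, MvPolynomial.eval y (f i) = 0} : ℝ)
                  - μ * (Fintype.card K : ℝ) ^ d|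
                ≤ C * (Fintype.card K : ℝ) ^ ((d : ℝ) - 1 / 2))
    (h27 : ∀ (m : ℕ) (φ : Language.ring.Formula (Fin m)),
      ∃ (B q₀ L : ℕ)
        (g : Fin L → Language.ring.Term (((Σ k : Fin B, Fin (k.1 + 2)) ⊕ Fin m) ⊕ Fin 1)),
        ∀ (K : Type) [Field K] [Fintype K], q₀ ≤ Fintype.card K →
          ∀ c : (Σ k : Fin B, Fin (k.1 + 2)) → K,
            (∀ k : Fin B, Irreducible (Polynomial.X ^ (k.1 + 2) +
              ∑ i : Fin (k.1 + 2), Polynomial.C (c ⟨k, i⟩) * Polynomial.X ^ (i : ℕ))) →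
            ∀ x : Fin m → K,
              (letI := compatibleRingOfRing K;
                (φ.Realize x ↔
                  ∀ l, ∃ t : K, (g l).realize (Sum.elim (Sum.elim c x) fun _ => t) = 0))) :
    ChatzidakisVanDenDriesMacintyre1992_mainTheorem :=
  mainTheorem_of_prop33_of_positiveQE
    (fun N r e => by
      obtain ⟨C, M, -, h⟩ := h33 e N r
      exact ⟨C, M, h⟩)
    (positiveQE_of_prop27 h27)

end PrintedInputs

end Literature.ModelTheory.PseudofiniteFields
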